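import Literature.Barriers.CriticalPhenomena.PlaquetteWalkHoleRootHoleColumnTop
import Literature.Barriers.CriticalPhenomena.PlaquetteWalkHoleRootSevenAboveFrameTwo
import HarnessLib

/-!
# Barrier catalogue (SAWScalingLimit): in the HOLE COLUMN the prefix of the straight level-`7` member IS THE HOOK, and every kiss is the first turning plaquette or the hook
plaquette («HOLE COLUMN: THE HOOK»)

`Z → ∞` limit model of the printed Yang–Baxter weights [GlazmanManolescu2019, §1, eq. (1)]; the «RECTANGLE COEFFICIENT» line (b-engine-1 g29), the frame of the
HOLE-COLUMN programme (FINDING-YB-HOLE-COLUMN-FOUR-PHASE; DESIGN-next b-engine-1 g28 §6 (a2)). With the excursion pinned from the first hit to the end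
(`ΩG.topClimb_of_cost_seven_straight_holeColumn_above`), the PREFIX is forced:

* ★★★ `ΩG.hook_of_cost_seven_straight_holeColumn_above`: the prefix runs straight east from the hole root to the first turning plaquette `p₁ = (x₁, w.2)`, `x₁ = w.1 + k₁`,
  turns `N` there, climbs the column `x₁` straight to the HOOK plaquette `h = (x₁, r.2)`, turns `W` there and runs straight west along the row of `r` into `r`
  (`F = 2k₁ + 1 + (r.2 − w.2)`); every plaquette carrying two arcs is `p₁` (exactly when the loop returns through it, `k₀ = x₁`) or `h` (exactly when the climb to the
  top goes through it, `c₂ = x₁`), and the arcs in them are the named ones; without the hook kiss `e_E = h` (`ME = k₁ + 1`). WHY: no prefix arc lies below the root row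
  (those plaquettes are the pinned legs and bottom row of the excursion), above the row of `r` (the pinned climb, top row and descent), or in the hole column and west of
  it (the hole, `r`, and discrete continuity); so `p₁` turns `N`, the column leads to `h`, `h` cannot be left upwards, nor eastwards (`e_E` would sit between `h` and the
  climb column with nowhere to turn), and westwards the row of `r` leads straight into `r`.

[GlazmanManolescu2019 §1 Fig. 1, eq. (1), Lemma 2.1, Remark 2.2; Glazman2015WeightedSAW Lemma 3.1 (proof, pp. 6–7); CourantRobbins1958 Ch. V App. §2 (the even–odd rule)]
-/

noncomputable section

namespace Literature.Probability.RandomPlanarGeometry.SAW.YangBaxter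

open Real
open Literature.Barriers.CriticalPhenomena.PlaquetteWalk

open private fc_fh fh_add_Mv three_le_Mv from Literature.Probability.RandomPlanarGeometry.YangBaxterSAWGeneralDomain
open private fc_sOut_pred_of_sIn_S fc_sOut_pred_of_sIn_N from Literature.Barriers.CriticalPhenomena.PlaquetteWalkStraightRuns
open private sIn_succ_eq_S sIn_succ_eq_N from Literature.Barriers.CriticalPhenomena.PlaquetteWalkKissChains

namespace ΩG

variable {D : Set Face} {w r : Face} {ω : ΩG D (w.side .W) r}

/-- ★★ **HOLE COLUMN: NO PREFIX ARC BELOW THE ROOT ROW.** In the setting of `topClimb_of_cost_seven_straight_holeColumn_above` every arc before the first hit of `r` lies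
on the root row or above it: the plaquettes below the root row that the walk visits are the two legs and the bottom row of the loop, all pinned at excursion indices.
[cite: GlazmanManolescu2019, §1, Fig. 1 and eq. (1); Lemma 2.1] [cite: CourantRobbins1958, Ch. V Appendix §2 (the even–odd rule)] -/
theorem prefix_row_ge_of_cost_seven_straight_holeColumn_above (hh : holeFaceW w ∉ D) (hr : RootedFace D (w.side .W) r) (h : ω.IsB2a)
    (hA : ω.AJ hr h (toC (midPt (w.side .W))) ≠ 0) (hc : cost (slotOfSide ω.1) ω.2.mids = 7) (hz : ω.1 = .N ∨ ω.1 = .S)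
    (hstr8 : arcKind (ω.2.sIn ω.2.firstHitG) (ω.2.sOut ω.2.firstHitG) = .straight) (hcol : r.1 = w.1 - 1) (habove : w.2 < r.2)
    (hup : ∃ j < ω.2.arcs.length, r.2 < (ω.2.fc j).2) :
    ∀ j < ω.2.firstHitG, w.2 ≤ (ω.2.fc j).2 := by
  classical
  set n := ω.2.arcs.length with hn
  ---------------------------------------------------------------- basics
  have hF := ω.fh_lt h
  have hlen : 0 < n := by omega
  have h0w : ω.2.fc 0 = w := fc_zero_eq_root w hh ω.2 hlen
  have h0W : ω.2.sIn 0 = .W := YBWalk.sIn_zero_eq_W hh ω.2 hlen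
  have h0E : ω.2.sIn 0 ≠ .E := by rw [h0W]; decide
  have h0N : ω.2.sIn 0 ≠ .N := by rw [h0W]; decide
  have h0S : ω.2.sIn 0 ≠ .S := by rw [h0W]; decide
  have hfcF := (fc_fh ω hr h).1
  have hsvr : ∀ l < n, ω.2.fc l = ω.2.fc ω.2.firstHitG → l = ω.2.firstHitG := fun l hl e => eq_firstHitG_of_fc_eq hr h hl e
  have hn1 : n - 1 < n := by omega
  have hwr : r.1 < w.1 := by omega
  ---------------------------------------------------------------- the climb to the top (car 44) with the seven turns
  obtain ⟨c₂, c₁, Y, Y', τ1, k₀, MW, ME, k₁, t₂, hY, hY', hr₃, hY'w, ht₂row, ht₂col, hτ1w, hMW1, hME1, hEW, hWW, hnotW, hWE, hEE, hnotE,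
    hseven, hall, hN1, hL, hLS, hdesc, hdescIn, heWS, heWnN, hlegN, hlegS, hbWnS, hk₁F, hstr, hk₁ns, hfk, hWk, hk₀w, hbotS, hbWnW, hbEnE, hbEnS,
    hinF, houtF, hrunR, hrunL, hrunB, hrunE, hi₀n, hpass, hclimb, hi₁n, ht₂, hTin, hMT, hrunT, hrunTin, htop⟩ :=
    topClimb_of_cost_seven_straight_holeColumn_above hh hr h hA hc hz hstr8 hcol habove hup
  -- hide the disjunctions and the `toNat`-carrying atoms from `omega` until they are rewritten
  have hpassF := Fact.mk hpass
  have htopF := Fact.mk htop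
  have hi₀nF := Fact.mk hi₀n
  have hi₁nF := Fact.mk hi₁n
  have hMTF := Fact.mk hMT
  clear hpass htop hi₀n hi₁n hMT ht₂col
  let P : Face → Prop := fun f => f ∈ facesL ω.2.mids ∧ (kindsL ω.2.mids f = [.corner] ∨ kindsL ω.2.mids f = [.coCorner])
  have hPiso : ∀ k < n, (∀ l < n, ω.2.fc l = ω.2.fc k → l = k) → arcKind (ω.2.sIn k) (ω.2.sOut k) ≠ .straight → P (ω.2.fc k) :=
    fun k hk hsv hkind => isolated_turn hk hsv hkind
  have hmem7 : ∀ f : Face, P f → f = ((r.1 : ℤ), Y) ∨ f = t₂ ∨ f = ((r.1 : ℤ) - MW, Y') ∨ f = (k₀, Y') ∨ f = ((τ1 : ℤ), w.2) ∨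
      f = ((r.1 : ℤ) - MW, r.2) ∨ f = ((r.1 : ℤ) + ME, r.2) := by
    intro f hPf
    have := hall f hPf.1 hPf.2
    simpa only [Finset.mem_insert, Finset.mem_singleton] using this
  have hProw : ∀ f : Face, P f → f.2 = Y ∨ f.2 = Y' ∨ f.2 = w.2 ∨ f.2 = r.2 := by
    intro f hPf
    rcases hmem7 f hPf with rfl | rfl | rfl | rfl | rfl | rfl | rfl
    · exact Or.inl rfl
    · exact Or.inl ht₂row
    · exact Or.inr (Or.inl rfl)
    · exact Or.inr (Or.inl rfl)
    · exact Or.inr (Or.inr (Or.inl rfl))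
    · exact Or.inr (Or.inr (Or.inr rfl))
    · exact Or.inr (Or.inr (Or.inr rfl))
  have hbots : ∀ f : Face, P f → f.2 = Y' → f = ((r.1 : ℤ) - MW, Y') ∨ f = (k₀, Y') := by
    intro f hPf hfY
    rcases hmem7 f hPf with e | e | e | e | e | e | e
    · exfalso; rw [e] at hfY; simp only at hfY; omega
    · exfalso; rw [e, ht₂row] at hfY; omega
    · exact Or.inl e
    · exact Or.inr e
    · exfalso; rw [e] at hfY; simp only at hfY; omega
    · exfalso; rw [e] at hfY; simp only at hfY; omega
    · exfalso; rw [e] at hfY; simp only at hfY; omega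
  have htops : ∀ f : Face, P f → f.2 = Y → f = ((r.1 : ℤ), Y) ∨ f = t₂ := by
    intro f hPf hfY
    rcases hmem7 f hPf with e | e | e | e | e | e | e
    · exact Or.inl e
    · exact Or.inr e
    · exfalso; rw [e] at hfY; simp only at hfY; omega
    · exfalso; rw [e] at hfY; simp only at hfY; omega
    · exfalso; rw [e] at hfY; simp only at hfY; omega
    · exfalso; rw [e] at hfY; simp only at hfY; omega
    · exfalso; rw [e] at hfY; simp only at hfY; omega
  obtain ⟨X', -, hX', -⟩ := exists_right_entry_turn hh hr h
  obtain ⟨X, hXw, hX, -⟩ := exists_left_entry_turn hh hr h hA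
  ---------------------------------------------------------------- rows: a plaquette using `E` or `W` lies on one of the four turn rows
  have hrowE : ∀ c : Face, ω.2.UsesSide c .E → c.2 = Y ∨ c.2 = Y' ∨ c.2 = w.2 ∨ c.2 = r.2 := by
    intro c hcE
    obtain ⟨M, hWall, -, hend⟩ := ω.2.chain_E hX' hcE
    rcases hend with ⟨hM1, hnot⟩ | ⟨-, hs0⟩ | ⟨-, hsZ⟩
    · obtain ⟨i', hi', hfc', hsv', -, -, -, hk'⟩ := ω.2.isolated_of_usesSide_not_opp (hWall M hM1 le_rfl) hnot
      have hP' : P (c.1 + M, c.2) := by rw [← hfc']; exact hPiso i' hi' hsv' hk'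
      have := hProw _ hP'; simp only at this; exact this
    · exact absurd hs0 h0E
    · rw [hLS] at hsZ; exact absurd hsZ (by decide)
  have hrowW : ∀ c : Face, ω.2.UsesSide c .W → c.2 = Y ∨ c.2 = Y' ∨ c.2 = w.2 ∨ c.2 = r.2 := by
    intro c hcW
    obtain ⟨M, hEall, -, hend⟩ := ω.2.chain_W hX hcW
    rcases hend with ⟨hM1, hnot⟩ | ⟨hA0, -⟩ | ⟨-, hsZ⟩
    · obtain ⟨i', hi', hfc', hsv', -, -, -, hk'⟩ := ω.2.isolated_of_usesSide_not_opp (hEall M hM1 le_rfl) hnot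
      have hP' : P (c.1 - M, c.2) := by rw [← hfc']; exact hPiso i' hi' hsv' hk'
      have := hProw _ hP'; simp only at this; exact this
    · rw [h0w] at hA0; have := congrArg Prod.snd hA0; simp only at this; exact Or.inr (Or.inr (Or.inl this))
    · rw [hLS] at hsZ; exact absurd hsZ (by decide)
  have hvert : ∀ i < n, (ω.2.fc i).2 ≠ Y → (ω.2.fc i).2 ≠ Y' → (ω.2.fc i).2 ≠ w.2 → (ω.2.fc i).2 ≠ r.2 →
      arcKind (ω.2.sIn i) (ω.2.sOut i) = .straight := by
    intro i hi h1 h2 h3 h4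
    have hnot : ¬(ω.2.UsesSide (ω.2.fc i) .E ∨ ω.2.UsesSide (ω.2.fc i) .W) := by
      rintro (hu | hu)
      · rcases hrowE _ hu with e | e | e | e
        · exact h1 e
        · exact h2 e
        · exact h3 e
        · exact h4 e
      · rcases hrowW _ hu with e | e | e | e
        · exact h1 e
        · exact h2 e
        · exact h3 e
        · exact h4 e
    have hiE : ω.2.sIn i ≠ .E := fun e => hnot (Or.inl ⟨i, hi, rfl, Or.inl e⟩)
    have hoE : ω.2.sOut i ≠ .E := fun e => hnot (Or.inl ⟨i, hi, rfl, Or.inr e⟩)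
    have hiW : ω.2.sIn i ≠ .W := fun e => hnot (Or.inr ⟨i, hi, rfl, Or.inl e⟩)
    have hoW : ω.2.sOut i ≠ .W := fun e => hnot (Or.inr ⟨i, hi, rfl, Or.inr e⟩)
    have hne := ω.2.sIn_ne_sOut hi
    revert hiE hoE hiW hoW hne
    cases ω.2.sIn i <;> cases ω.2.sOut i <;> decide
  ---------------------------------------------------------------- abbreviations for the pinned indices
  obtain ⟨dB, hdB⟩ : ∃ dB : ℕ, (dB : ℤ) = w.2 - Y' - 1 := ⟨(w.2 - Y' - 1).toNat, by omega⟩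
  obtain ⟨dR, hdR⟩ : ∃ dR : ℕ, (dR : ℤ) = k₀ - (r.1 - MW) - 1 := ⟨(k₀ - (r.1 - MW) - 1).toNat, by omega⟩
  obtain ⟨dL, hdL⟩ : ∃ dL : ℕ, (dL : ℤ) = r.2 - Y' - 1 := ⟨(r.2 - Y' - 1).toNat, by omega⟩
  obtain ⟨dM, hdM⟩ : ∃ dM : ℕ, (dM : ℤ) = r.2 - w.2 - 1 := ⟨(r.2 - w.2 - 1).toNat, by omega⟩
  obtain ⟨dT, hdT⟩ : ∃ dT : ℕ, (dT : ℤ) = Y - r.2 - 1 := ⟨(Y - r.2 - 1).toNat, by omega⟩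
  have htoNat : ∀ (a : ℤ) (k : ℕ), a = k → a.toNat = k := fun a k e => by subst e; exact Int.toNat_natCast k
  set x₁ : ℤ := w.1 + k₁ with hx₁def
  have hc₁x : x₁ < c₁ := by rcases hpassF.out with ⟨e1, e2, e3, -⟩ | ⟨e1, -, e3, -⟩ <;> omega
  have hc₂ : c₂ = c₁ ∨ c₂ = x₁ := by rcases htopF.out with ⟨e, -⟩ | ⟨e, -⟩ <;> [exact Or.inl e; exact Or.inr e]
  have hc₂r : r.1 < c₂ := by rcases hc₂ with e | e <;> omega
  have hc₂F := Fact.mk hc₂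
  clear hc₂
  obtain ⟨dC, hdC⟩ : ∃ dC : ℕ, (dC : ℤ) = c₁ - k₀ := ⟨(c₁ - k₀).toNat, by rcases hpassF.out with ⟨e1, e2, e3, -⟩ | ⟨e1, -, e3, -⟩ <;> omega⟩
  obtain ⟨dH, hdH⟩ : ∃ dH : ℕ, (dH : ℤ) = c₁ - x₁ - 1 := ⟨(c₁ - x₁ - 1).toNat, by omega⟩
  obtain ⟨d₂, hd₂⟩ : ∃ d₂ : ℕ, (d₂ : ℤ) = c₂ - r.1 := ⟨(c₂ - r.1).toNat, by omega⟩
  obtain ⟨jB, hjB⟩ : ∃ jB : ℕ, ω.2.firstHitG + MW + (dL + 1) = jB := ⟨_, rfl⟩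
  obtain ⟨jE, hjE⟩ : ∃ jE : ℕ, jB + (dR + 1) = jE := ⟨_, rfl⟩
  obtain ⟨i₀, hi₀⟩ : ∃ i₀ : ℕ, jE + (dB + 1) = i₀ := ⟨_, rfl⟩
  obtain ⟨iC, hiC⟩ : ∃ iC : ℕ, i₀ + dC = iC := ⟨_, rfl⟩
  obtain ⟨i₁, hi₁⟩ : ∃ i₁ : ℕ, iC + (dM + 1) = i₁ := ⟨_, rfl⟩
  obtain ⟨jT, hjT⟩ : ∃ jT : ℕ, n - 1 - dT = jT := ⟨_, rfl⟩
  have eLF : Fact ((r.2 - Y').toNat = dL + 1) := ⟨htoNat _ _ (by push_cast; omega)⟩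
  have eRF : Fact ((k₀ - (r.1 - MW)).toNat = dR + 1) := ⟨htoNat _ _ (by push_cast; omega)⟩
  have eBF : Fact ((w.2 - Y').toNat = dB + 1) := ⟨htoNat _ _ (by push_cast; omega)⟩
  have eCF : Fact ((c₁ - k₀).toNat = dC) := ⟨htoNat _ _ (by omega)⟩
  have eMF : Fact ((r.2 - w.2).toNat = dM + 1) := ⟨htoNat _ _ (by push_cast; omega)⟩
  have eTF : Fact ((Y - r.2 - 1).toNat = dT) := ⟨htoNat _ _ (by omega)⟩
  have eT1F : Fact ((Y - r.2).toNat = dT + 1) := ⟨htoNat _ _ (by push_cast; omega)⟩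
  have e₂F : Fact ((c₂ - r.1).toNat = d₂) := ⟨htoNat _ _ (by omega)⟩
  have eHF : Fact ((c₁ - (w.1 + (k₁ : ℤ))).toNat = dH + 1) := ⟨htoNat _ _ (by push_cast; omega)⟩
  have hIDX0F : Fact (ω.2.firstHitG + MW + (r.2 - Y').toNat + (k₀ - (r.1 - MW)).toNat + (w.2 - Y').toNat = i₀) :=
    ⟨by rw [eLF.out, eRF.out, eBF.out]; omega⟩
  have hIDX1F : Fact (ω.2.firstHitG + MW + (r.2 - Y').toNat + (k₀ - (r.1 - MW)).toNat + (w.2 - Y').toNat + (c₁ - k₀).toNat +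
      (r.2 - w.2).toNat = i₁) := ⟨by rw [eLF.out, eRF.out, eBF.out, eCF.out, eMF.out]; omega⟩
  have hTOPF : Fact (n - 1 - (Y - r.2 - 1).toNat = jT) := ⟨by rw [eTF.out]; exact hjT⟩
  rw [eLF.out] at hrunB
  rw [eLF.out, eRF.out] at hrunE
  have hi₀n := hi₀nF.out
  rw [hIDX0F.out] at hi₀n
  rw [hIDX0F.out, eCF.out] at hclimb
  have hi₁n := hi₁nF.out
  rw [hIDX1F.out] at hi₁n
  have hMT := hMTF.out
  rw [hTOPF.out, e₂F.out] at hMT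
  rw [hTOPF.out] at hTin hrunT hrunTin
  rw [hjB] at hrunB hrunE
  rw [hjE] at hrunE
  rw [show i₀ + dC = iC from hiC] at hclimb
  clear hi₀nF hi₁nF hMTF
  have hiC₀ : i₀ ≤ iC := by omega
  have hFi₀ : ω.2.firstHitG < i₀ := by omega
  have hjTn : jT < n := by omega
  have hNtop := forall_top_ne_N hh hr h hY (by omega)
  have hfcT : ω.2.fc jT = (r.1, Y) := by have := hrunT 0 (by omega); rwa [Nat.sub_zero, Nat.cast_zero, add_zero] at this
  ---------------------------------------------------------------- (P1) no prefix arc below the root row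
  have hlow : ∀ j < ω.2.firstHitG, w.2 ≤ (ω.2.fc j).2 := by
    intro j hj
    by_contra hlt
    push Not at hlt
    have hjn : j < n := lt_trans hj hF
    have hge : Y' ≤ (ω.2.fc j).2 := hY' j hjn
    rcases eq_or_lt_of_le hge with heq | hgt
    · -- on the bottom row: a straight cell of the bottom run, or one of the two bottom turns
      set c := ω.2.fc j with hc
      have hcS : ¬ω.2.UsesSide c .S := by rw [show c = (c.1, Y') from Prod.ext rfl heq.symm]; exact hbotS c.1
      -- the arc at `j` uses `E` or `W`
      have hEW : ω.2.UsesSide c .E ∨ ω.2.UsesSide c .W := by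
        have hne := ω.2.sIn_ne_sOut hjn
        have h1 : ω.2.sIn j ≠ .S := fun e => hcS ⟨j, hjn, rfl, Or.inl e⟩
        have h2 : ω.2.sOut j ≠ .S := fun e => hcS ⟨j, hjn, rfl, Or.inr e⟩
        have key : ∀ s t : Side, s ≠ t → s ≠ .S → t ≠ .S → (s = .E ∨ t = .E) ∨ (s = .W ∨ t = .W) := by decide
        rcases key _ _ hne h1 h2 with hE | hW
        · exact Or.inl ⟨j, hjn, rfl, hE⟩
        · exact Or.inr ⟨j, hjn, rfl, hW⟩
      -- its column lies between the bottom turns (inclusive)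
      have hcolE : ω.2.UsesSide c .E → c.1 < k₀ := by
        intro hu
        obtain ⟨M, hWall, -, hend⟩ := ω.2.chain_E hX' hu
        rcases hend with ⟨hM1, hnot⟩ | ⟨-, hs0⟩ | ⟨-, hsZ⟩
        · obtain ⟨i', hi', hfc', hsv', -, -, -, hk'⟩ := ω.2.isolated_of_usesSide_not_opp (hWall M hM1 le_rfl) hnot
          have hP' : P (c.1 + M, c.2) := by rw [← hfc']; exact hPiso i' hi' hsv' hk'
          rcases hbots _ hP' (by simp only; omega) with e | e
          · have := congrArg Prod.fst e; simp only at this; omega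
          · have := congrArg Prod.fst e; simp only at this; omega
        · exact absurd hs0 h0E
        · rw [hLS] at hsZ; exact absurd hsZ (by decide)
      have hcolW : ω.2.UsesSide c .W → r.1 - MW < c.1 := by
        intro hu
        obtain ⟨M, hEall, -, hend⟩ := ω.2.chain_W hX hu
        rcases hend with ⟨hM1, hnot⟩ | ⟨hA0, -⟩ | ⟨-, hsZ⟩
        · obtain ⟨i', hi', hfc', hsv', -, -, -, hk'⟩ := ω.2.isolated_of_usesSide_not_opp (hEall M hM1 le_rfl) hnot
          have hP' : P (c.1 - M, c.2) := by rw [← hfc']; exact hPiso i' hi' hsv' hk'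
          rcases hbots _ hP' (by simp only; omega) with e | e
          · have := congrArg Prod.fst e; simp only at this; omega
          · have := congrArg Prod.fst e; simp only at this; omega
        · rw [h0w] at hA0; have := congrArg Prod.snd hA0; simp only at this; omega
        · rw [hLS] at hsZ; exact absurd hsZ (by decide)
      -- the bottom turns and the straight cells between them are pinned excursion cells, singly visited
      have hsvbot : ∀ x : ℤ, r.1 - MW ≤ x → x ≤ k₀ → ∀ l < n, ω.2.fc l = (x, Y') → ω.2.firstHitG < l := by
        intro x hx1 hx2 l hl hfl
        obtain ⟨m, hm⟩ : ∃ m : ℕ, (m : ℤ) = x - (r.1 - MW) := ⟨(x - (r.1 - MW)).toNat, by omega⟩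
        -- the pinned index of `(x, Y')`
        have hpin : ω.2.fc (jB + m) = (x, Y') := by
          rcases Nat.eq_zero_or_pos m with h0 | hpos
          · subst h0
            obtain ⟨e, -⟩ := hrunL (dL + 1) (by omega) (by omega)
            rw [show ω.2.firstHitG + MW + (dL + 1) = jB + 0 by omega] at e
            rw [e]; exact Prod.ext (by simp only; omega) (by simp only; omega)
          · obtain ⟨e, -⟩ := hrunB m hpos (by omega)
            rw [e]; exact Prod.ext (by simp only; omega) rfl
        -- `(x, Y')` does not use `S`, hence is singly visited
        have := ω.2.single_visit_of_not_usesSide (hbotS x) hl (show jB + m < n by omega) hfl hpin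
        omega
      have hx : r.1 - MW ≤ c.1 ∧ c.1 ≤ k₀ := by
        rcases hEW with hu | hu
        · refine ⟨?_, by have := hcolE hu; omega⟩
          by_contra hlt'
          push Not at hlt'
          -- `c` uses `E` but not `W` west of `b_W`: an isolated bottom-row turn other than the two
          by_cases hW : ω.2.UsesSide c .W
          · have := hcolW hW; omega
          · obtain ⟨i', hi', hfc', hsv', -, -, -, hk'⟩ := ω.2.isolated_of_usesSide_not_opp hu hW
            have hP' : P c := by rw [← hfc']; exact hPiso i' hi' hsv' hk'
            rcases hbots _ hP' heq.symm with e | e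
            · have := congrArg Prod.fst e; simp only at this; omega
            · have := congrArg Prod.fst e; simp only at this; omega
        · refine ⟨by have := hcolW hu; omega, ?_⟩
          by_contra hlt'
          push Not at hlt'
          by_cases hE : ω.2.UsesSide c .E
          · have := hcolE hE; omega
          · obtain ⟨i', hi', hfc', hsv', -, -, -, hk'⟩ := ω.2.isolated_of_usesSide_not_opp hu hE
            have hP' : P c := by rw [← hfc']; exact hPiso i' hi' hsv' hk'
            rcases hbots _ hP' heq.symm with e | e
            · have := congrArg Prod.fst e; simp only at this; omega
            · have := congrArg Prod.fst e; simp only at this; omega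
      have := hsvbot c.1 hx.1 hx.2 j hjn (Prod.ext rfl heq.symm)
      omega
    · -- strictly between the bottom row and the root row: a vertical cell of one of the two legs
      have hk := hvert j hjn (by omega) (by omega) (by omega) (by omega)
      have hcS : ω.2.UsesSide (ω.2.fc j) .S := by
        have key : ∀ s t : Side, arcKind s t = .straight → s ≠ .E → s ≠ .W → (s = .S ∨ t = .S) := by decide
        have hiE : ω.2.sIn j ≠ .E := fun e => by
          rcases hrowE _ ⟨j, hjn, rfl, Or.inl e⟩ with e' | e' | e' | e' <;> omega
        have hiW : ω.2.sIn j ≠ .W := fun e => by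
          rcases hrowW _ ⟨j, hjn, rfl, Or.inl e⟩ with e' | e' | e' | e' <;> omega
        exact ⟨j, hjn, rfl, key _ _ hk hiE hiW⟩
      obtain ⟨M, hNall, -, hend⟩ := ω.2.chain_S hY' hcS
      have hcol' : (ω.2.fc j).1 = r.1 - MW ∨ (ω.2.fc j).1 = k₀ := by
        rcases hend with ⟨hM1, hnot⟩ | ⟨hA0, -⟩ | ⟨hZ, -⟩
        · obtain ⟨i', hi', hfc', hsv', -, -, -, hk'⟩ := ω.2.isolated_of_usesSide_not_opp (hNall M hM1 le_rfl) hnot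
          have hP' : P ((ω.2.fc j).1, (ω.2.fc j).2 - M) := by rw [← hfc']; exact hPiso i' hi' hsv' hk'
          have hrow' : ((((ω.2.fc j).1, (ω.2.fc j).2 - M) : Face)).2 = Y' := by
            rcases hProw _ hP' with e | e | e | e <;> simp only at e ⊢ <;> omega
          rcases hbots _ hP' hrow' with e | e
          · have := congrArg Prod.fst e; simp only at this; exact Or.inl this
          · have := congrArg Prod.fst e; simp only at this; exact Or.inr this
        · rw [h0w] at hA0; have := congrArg Prod.snd hA0; simp only at this; omega
        · rw [hL] at hZ; have := congrArg Prod.snd hZ; simp only at this; omega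
      -- single visit of a straight cell
      have hsv : ∀ l < n, ω.2.fc l = ω.2.fc j → l = j := by
        intro l hl e
        by_contra hne
        exact (YBWalk.not_straight_of_two_arcs (γ := ω.2) (i := j) (i' := l) hjn hl (Ne.symm hne) e).1 (ω.2.sOut_of_straight hjn hk)
      rcases hcol' with hcw | hce
      · -- west leg: `(r.1 − MW, r.2 − m)` at `F + MW + m`
        obtain ⟨m, hm⟩ : ∃ m : ℕ, (m : ℤ) = r.2 - (ω.2.fc j).2 := ⟨(r.2 - (ω.2.fc j).2).toNat, by omega⟩
        obtain ⟨e, -⟩ := hrunL m (by omega) (by omega)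
        have := hsv (ω.2.firstHitG + MW + m) (by omega) (by rw [e]; exact Prod.ext (by simp only; omega) (by simp only; omega))
        omega
      · -- east leg: `(k₀, Y' + m)` at `jE + m`
        obtain ⟨m, hm⟩ : ∃ m : ℕ, (m : ℤ) = (ω.2.fc j).2 - Y' := ⟨((ω.2.fc j).2 - Y').toNat, by omega⟩
        obtain ⟨e, -⟩ := hrunE m (by omega) (by omega)
        have := hsv (jE + m) (by omega) (by rw [e]; exact Prod.ext (by simp only; omega) (by simp only; omega))
        omega
  exact hlow

/-- ★★ **HOLE COLUMN: NO PREFIX ARC ABOVE THE ROW OF `r`.** In the setting of `topClimb_of_cost_seven_straight_holeColumn_above` every arc before the first hit of `r`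
lies on the row of `r` or below it: above it the walk only visits the final climb, the top row between `T` and `t₂`, and the final descent, all pinned at excursion indices.
[cite: GlazmanManolescu2019, §1, Fig. 1 and eq. (1); Lemma 2.1] [cite: CourantRobbins1958, Ch. V Appendix §2 (the even–odd rule)] -/
theorem prefix_row_le_of_cost_seven_straight_holeColumn_above (hh : holeFaceW w ∉ D) (hr : RootedFace D (w.side .W) r) (h : ω.IsB2a)
    (hA : ω.AJ hr h (toC (midPt (w.side .W))) ≠ 0) (hc : cost (slotOfSide ω.1) ω.2.mids = 7) (hz : ω.1 = .N ∨ ω.1 = .S)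
    (hstr8 : arcKind (ω.2.sIn ω.2.firstHitG) (ω.2.sOut ω.2.firstHitG) = .straight) (hcol : r.1 = w.1 - 1) (habove : w.2 < r.2)
    (hup : ∃ j < ω.2.arcs.length, r.2 < (ω.2.fc j).2) :
    ∀ j < ω.2.firstHitG, (ω.2.fc j).2 ≤ r.2 := by
  classical
  set n := ω.2.arcs.length with hn
  ---------------------------------------------------------------- basics
  have hF := ω.fh_lt h
  have hlen : 0 < n := by omega
  have h0w : ω.2.fc 0 = w := fc_zero_eq_root w hh ω.2 hlen
  have h0W : ω.2.sIn 0 = .W := YBWalk.sIn_zero_eq_W hh ω.2 hlen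
  have h0E : ω.2.sIn 0 ≠ .E := by rw [h0W]; decide
  have h0N : ω.2.sIn 0 ≠ .N := by rw [h0W]; decide
  have h0S : ω.2.sIn 0 ≠ .S := by rw [h0W]; decide
  have hfcF := (fc_fh ω hr h).1
  have hsvr : ∀ l < n, ω.2.fc l = ω.2.fc ω.2.firstHitG → l = ω.2.firstHitG := fun l hl e => eq_firstHitG_of_fc_eq hr h hl e
  have hn1 : n - 1 < n := by omega
  have hwr : r.1 < w.1 := by omega
  ---------------------------------------------------------------- the climb to the top (car 44) with the seven turns
  obtain ⟨c₂, c₁, Y, Y', τ1, k₀, MW, ME, k₁, t₂, hY, hY', hr₃, hY'w, ht₂row, ht₂col, hτ1w, hMW1, hME1, hEW, hWW, hnotW, hWE, hEE, hnotE,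
    hseven, hall, hN1, hL, hLS, hdesc, hdescIn, heWS, heWnN, hlegN, hlegS, hbWnS, hk₁F, hstr, hk₁ns, hfk, hWk, hk₀w, hbotS, hbWnW, hbEnE, hbEnS,
    hinF, houtF, hrunR, hrunL, hrunB, hrunE, hi₀n, hpass, hclimb, hi₁n, ht₂, hTin, hMT, hrunT, hrunTin, htop⟩ :=
    topClimb_of_cost_seven_straight_holeColumn_above hh hr h hA hc hz hstr8 hcol habove hup
  -- hide the disjunctions and the `toNat`-carrying atoms from `omega` until they are rewritten
  have hpassF := Fact.mk hpass
  have htopF := Fact.mk htop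
  have hi₀nF := Fact.mk hi₀n
  have hi₁nF := Fact.mk hi₁n
  have hMTF := Fact.mk hMT
  clear hpass htop hi₀n hi₁n hMT ht₂col
  let P : Face → Prop := fun f => f ∈ facesL ω.2.mids ∧ (kindsL ω.2.mids f = [.corner] ∨ kindsL ω.2.mids f = [.coCorner])
  have hPiso : ∀ k < n, (∀ l < n, ω.2.fc l = ω.2.fc k → l = k) → arcKind (ω.2.sIn k) (ω.2.sOut k) ≠ .straight → P (ω.2.fc k) :=
    fun k hk hsv hkind => isolated_turn hk hsv hkind
  have hmem7 : ∀ f : Face, P f → f = ((r.1 : ℤ), Y) ∨ f = t₂ ∨ f = ((r.1 : ℤ) - MW, Y') ∨ f = (k₀, Y') ∨ f = ((τ1 : ℤ), w.2) ∨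
      f = ((r.1 : ℤ) - MW, r.2) ∨ f = ((r.1 : ℤ) + ME, r.2) := by
    intro f hPf
    have := hall f hPf.1 hPf.2
    simpa only [Finset.mem_insert, Finset.mem_singleton] using this
  have hProw : ∀ f : Face, P f → f.2 = Y ∨ f.2 = Y' ∨ f.2 = w.2 ∨ f.2 = r.2 := by
    intro f hPf
    rcases hmem7 f hPf with rfl | rfl | rfl | rfl | rfl | rfl | rfl
    · exact Or.inl rfl
    · exact Or.inl ht₂row
    · exact Or.inr (Or.inl rfl)
    · exact Or.inr (Or.inl rfl)
    · exact Or.inr (Or.inr (Or.inl rfl))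
    · exact Or.inr (Or.inr (Or.inr rfl))
    · exact Or.inr (Or.inr (Or.inr rfl))
  have hbots : ∀ f : Face, P f → f.2 = Y' → f = ((r.1 : ℤ) - MW, Y') ∨ f = (k₀, Y') := by
    intro f hPf hfY
    rcases hmem7 f hPf with e | e | e | e | e | e | e
    · exfalso; rw [e] at hfY; simp only at hfY; omega
    · exfalso; rw [e, ht₂row] at hfY; omega
    · exact Or.inl e
    · exact Or.inr e
    · exfalso; rw [e] at hfY; simp only at hfY; omega
    · exfalso; rw [e] at hfY; simp only at hfY; omega
    · exfalso; rw [e] at hfY; simp only at hfY; omega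
  have htops : ∀ f : Face, P f → f.2 = Y → f = ((r.1 : ℤ), Y) ∨ f = t₂ := by
    intro f hPf hfY
    rcases hmem7 f hPf with e | e | e | e | e | e | e
    · exact Or.inl e
    · exact Or.inr e
    · exfalso; rw [e] at hfY; simp only at hfY; omega
    · exfalso; rw [e] at hfY; simp only at hfY; omega
    · exfalso; rw [e] at hfY; simp only at hfY; omega
    · exfalso; rw [e] at hfY; simp only at hfY; omega
    · exfalso; rw [e] at hfY; simp only at hfY; omega
  obtain ⟨X', -, hX', -⟩ := exists_right_entry_turn hh hr h
  obtain ⟨X, hXw, hX, -⟩ := exists_left_entry_turn hh hr h hA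
  ---------------------------------------------------------------- rows: a plaquette using `E` or `W` lies on one of the four turn rows
  have hrowE : ∀ c : Face, ω.2.UsesSide c .E → c.2 = Y ∨ c.2 = Y' ∨ c.2 = w.2 ∨ c.2 = r.2 := by
    intro c hcE
    obtain ⟨M, hWall, -, hend⟩ := ω.2.chain_E hX' hcE
    rcases hend with ⟨hM1, hnot⟩ | ⟨-, hs0⟩ | ⟨-, hsZ⟩
    · obtain ⟨i', hi', hfc', hsv', -, -, -, hk'⟩ := ω.2.isolated_of_usesSide_not_opp (hWall M hM1 le_rfl) hnot
      have hP' : P (c.1 + M, c.2) := by rw [← hfc']; exact hPiso i' hi' hsv' hk'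
      have := hProw _ hP'; simp only at this; exact this
    · exact absurd hs0 h0E
    · rw [hLS] at hsZ; exact absurd hsZ (by decide)
  have hrowW : ∀ c : Face, ω.2.UsesSide c .W → c.2 = Y ∨ c.2 = Y' ∨ c.2 = w.2 ∨ c.2 = r.2 := by
    intro c hcW
    obtain ⟨M, hEall, -, hend⟩ := ω.2.chain_W hX hcW
    rcases hend with ⟨hM1, hnot⟩ | ⟨hA0, -⟩ | ⟨-, hsZ⟩
    · obtain ⟨i', hi', hfc', hsv', -, -, -, hk'⟩ := ω.2.isolated_of_usesSide_not_opp (hEall M hM1 le_rfl) hnot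
      have hP' : P (c.1 - M, c.2) := by rw [← hfc']; exact hPiso i' hi' hsv' hk'
      have := hProw _ hP'; simp only at this; exact this
    · rw [h0w] at hA0; have := congrArg Prod.snd hA0; simp only at this; exact Or.inr (Or.inr (Or.inl this))
    · rw [hLS] at hsZ; exact absurd hsZ (by decide)
  have hvert : ∀ i < n, (ω.2.fc i).2 ≠ Y → (ω.2.fc i).2 ≠ Y' → (ω.2.fc i).2 ≠ w.2 → (ω.2.fc i).2 ≠ r.2 →
      arcKind (ω.2.sIn i) (ω.2.sOut i) = .straight := by
    intro i hi h1 h2 h3 h4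
    have hnot : ¬(ω.2.UsesSide (ω.2.fc i) .E ∨ ω.2.UsesSide (ω.2.fc i) .W) := by
      rintro (hu | hu)
      · rcases hrowE _ hu with e | e | e | e
        · exact h1 e
        · exact h2 e
        · exact h3 e
        · exact h4 e
      · rcases hrowW _ hu with e | e | e | e
        · exact h1 e
        · exact h2 e
        · exact h3 e
        · exact h4 e
    have hiE : ω.2.sIn i ≠ .E := fun e => hnot (Or.inl ⟨i, hi, rfl, Or.inl e⟩)
    have hoE : ω.2.sOut i ≠ .E := fun e => hnot (Or.inl ⟨i, hi, rfl, Or.inr e⟩)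
    have hiW : ω.2.sIn i ≠ .W := fun e => hnot (Or.inr ⟨i, hi, rfl, Or.inl e⟩)
    have hoW : ω.2.sOut i ≠ .W := fun e => hnot (Or.inr ⟨i, hi, rfl, Or.inr e⟩)
    have hne := ω.2.sIn_ne_sOut hi
    revert hiE hoE hiW hoW hne
    cases ω.2.sIn i <;> cases ω.2.sOut i <;> decide
  ---------------------------------------------------------------- abbreviations for the pinned indices
  obtain ⟨dB, hdB⟩ : ∃ dB : ℕ, (dB : ℤ) = w.2 - Y' - 1 := ⟨(w.2 - Y' - 1).toNat, by omega⟩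
  obtain ⟨dR, hdR⟩ : ∃ dR : ℕ, (dR : ℤ) = k₀ - (r.1 - MW) - 1 := ⟨(k₀ - (r.1 - MW) - 1).toNat, by omega⟩
  obtain ⟨dL, hdL⟩ : ∃ dL : ℕ, (dL : ℤ) = r.2 - Y' - 1 := ⟨(r.2 - Y' - 1).toNat, by omega⟩
  obtain ⟨dM, hdM⟩ : ∃ dM : ℕ, (dM : ℤ) = r.2 - w.2 - 1 := ⟨(r.2 - w.2 - 1).toNat, by omega⟩
  obtain ⟨dT, hdT⟩ : ∃ dT : ℕ, (dT : ℤ) = Y - r.2 - 1 := ⟨(Y - r.2 - 1).toNat, by omega⟩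
  have htoNat : ∀ (a : ℤ) (k : ℕ), a = k → a.toNat = k := fun a k e => by subst e; exact Int.toNat_natCast k
  set x₁ : ℤ := w.1 + k₁ with hx₁def
  have hc₁x : x₁ < c₁ := by rcases hpassF.out with ⟨e1, e2, e3, -⟩ | ⟨e1, -, e3, -⟩ <;> omega
  have hc₂ : c₂ = c₁ ∨ c₂ = x₁ := by rcases htopF.out with ⟨e, -⟩ | ⟨e, -⟩ <;> [exact Or.inl e; exact Or.inr e]
  have hc₂r : r.1 < c₂ := by rcases hc₂ with e | e <;> omega
  have hc₂F := Fact.mk hc₂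
  clear hc₂
  obtain ⟨dC, hdC⟩ : ∃ dC : ℕ, (dC : ℤ) = c₁ - k₀ := ⟨(c₁ - k₀).toNat, by rcases hpassF.out with ⟨e1, e2, e3, -⟩ | ⟨e1, -, e3, -⟩ <;> omega⟩
  obtain ⟨dH, hdH⟩ : ∃ dH : ℕ, (dH : ℤ) = c₁ - x₁ - 1 := ⟨(c₁ - x₁ - 1).toNat, by omega⟩
  obtain ⟨d₂, hd₂⟩ : ∃ d₂ : ℕ, (d₂ : ℤ) = c₂ - r.1 := ⟨(c₂ - r.1).toNat, by omega⟩
  obtain ⟨jB, hjB⟩ : ∃ jB : ℕ, ω.2.firstHitG + MW + (dL + 1) = jB := ⟨_, rfl⟩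
  obtain ⟨jE, hjE⟩ : ∃ jE : ℕ, jB + (dR + 1) = jE := ⟨_, rfl⟩
  obtain ⟨i₀, hi₀⟩ : ∃ i₀ : ℕ, jE + (dB + 1) = i₀ := ⟨_, rfl⟩
  obtain ⟨iC, hiC⟩ : ∃ iC : ℕ, i₀ + dC = iC := ⟨_, rfl⟩
  obtain ⟨i₁, hi₁⟩ : ∃ i₁ : ℕ, iC + (dM + 1) = i₁ := ⟨_, rfl⟩
  obtain ⟨jT, hjT⟩ : ∃ jT : ℕ, n - 1 - dT = jT := ⟨_, rfl⟩
  have eLF : Fact ((r.2 - Y').toNat = dL + 1) := ⟨htoNat _ _ (by push_cast; omega)⟩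
  have eRF : Fact ((k₀ - (r.1 - MW)).toNat = dR + 1) := ⟨htoNat _ _ (by push_cast; omega)⟩
  have eBF : Fact ((w.2 - Y').toNat = dB + 1) := ⟨htoNat _ _ (by push_cast; omega)⟩
  have eCF : Fact ((c₁ - k₀).toNat = dC) := ⟨htoNat _ _ (by omega)⟩
  have eMF : Fact ((r.2 - w.2).toNat = dM + 1) := ⟨htoNat _ _ (by push_cast; omega)⟩
  have eTF : Fact ((Y - r.2 - 1).toNat = dT) := ⟨htoNat _ _ (by omega)⟩
  have eT1F : Fact ((Y - r.2).toNat = dT + 1) := ⟨htoNat _ _ (by push_cast; omega)⟩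
  have e₂F : Fact ((c₂ - r.1).toNat = d₂) := ⟨htoNat _ _ (by omega)⟩
  have eHF : Fact ((c₁ - (w.1 + (k₁ : ℤ))).toNat = dH + 1) := ⟨htoNat _ _ (by push_cast; omega)⟩
  have hIDX0F : Fact (ω.2.firstHitG + MW + (r.2 - Y').toNat + (k₀ - (r.1 - MW)).toNat + (w.2 - Y').toNat = i₀) :=
    ⟨by rw [eLF.out, eRF.out, eBF.out]; omega⟩
  have hIDX1F : Fact (ω.2.firstHitG + MW + (r.2 - Y').toNat + (k₀ - (r.1 - MW)).toNat + (w.2 - Y').toNat + (c₁ - k₀).toNat +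
      (r.2 - w.2).toNat = i₁) := ⟨by rw [eLF.out, eRF.out, eBF.out, eCF.out, eMF.out]; omega⟩
  have hTOPF : Fact (n - 1 - (Y - r.2 - 1).toNat = jT) := ⟨by rw [eTF.out]; exact hjT⟩
  rw [eLF.out] at hrunB
  rw [eLF.out, eRF.out] at hrunE
  have hi₀n := hi₀nF.out
  rw [hIDX0F.out] at hi₀n
  rw [hIDX0F.out, eCF.out] at hclimb
  have hi₁n := hi₁nF.out
  rw [hIDX1F.out] at hi₁n
  have hMT := hMTF.out
  rw [hTOPF.out, e₂F.out] at hMT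
  rw [hTOPF.out] at hTin hrunT hrunTin
  rw [hjB] at hrunB hrunE
  rw [hjE] at hrunE
  rw [show i₀ + dC = iC from hiC] at hclimb
  clear hi₀nF hi₁nF hMTF
  -- the final climb column from `htop`
  have hclimbTop : ∃ j₀ : ℕ, i₁ ≤ j₀ ∧ j₀ + (dT + 1) = jT - d₂ ∧
      ∀ m : ℕ, 1 ≤ m → (m : ℤ) ≤ Y - r.2 → ω.2.fc (j₀ + m) = (c₂, r.2 + m) ∧ ω.2.sIn (j₀ + m) = .S := by
    rcases htopF.out with ⟨hcc, -, hrunUp, hidx⟩ | ⟨hcc, -, -, -, -, hrunUp, hidx⟩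
    · rw [hIDX1F.out, eT1F.out, hTOPF.out, e₂F.out] at hidx; rw [hIDX1F.out] at hrunUp
      exact ⟨i₁, le_rfl, hidx, by rw [hcc]; exact hrunUp⟩
    · rw [hIDX1F.out, eHF.out, eT1F.out, hTOPF.out, e₂F.out] at hidx; rw [hIDX1F.out, eHF.out] at hrunUp
      exact ⟨i₁ + (dH + 1), by omega, hidx, by rw [hcc]; exact hrunUp⟩
  obtain ⟨j₀, hi₁j₀, hj₀T, hrunUp⟩ := hclimbTop
  have hFj₀ : ω.2.firstHitG < j₀ := by omega
  have hiC₀ : i₀ ≤ iC := by omega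
  have hFi₀ : ω.2.firstHitG < i₀ := by omega
  have hjTn : jT < n := by omega
  have hi₁jT : i₁ < jT := by omega
  have hNtop := forall_top_ne_N hh hr h hY (by omega)
  have hfcT : ω.2.fc jT = (r.1, Y) := by have := hrunT 0 (by omega); rwa [Nat.sub_zero, Nat.cast_zero, add_zero] at this
  ---------------------------------------------------------------- (P2) no prefix arc above the row of `r`
  -- the top turns: `T` uses `E` (entered from `E`) and is left through `S`; `t₂` does not use `E`
  have hTE : ω.2.UsesSide ((r.1 : ℤ), Y) .E := ⟨jT, hjTn, hfcT, Or.inl hTin⟩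
  have hTnN : ¬ω.2.UsesSide ((r.1 : ℤ), Y) .N := by
    rintro ⟨l', hl', hfl', hs'⟩
    have := hNtop l' hl' (by rw [hfl'])
    rcases hs' with hs' | hs'
    · exact this.1 hs'
    · exact this.2 hs'
  have hTS : ω.2.sOut jT = .S := by
    rcases Nat.eq_zero_or_pos dT with h0 | hpos
    · have : jT = n - 1 := by omega
      rw [this]; exact hLS
    · have hin := hdescIn (dT - 1) (by rw [Nat.cast_sub (by omega : 1 ≤ dT)]; push_cast; omega)
      have := (fc_sOut_pred_of_sIn_N ω.2 (i := n - 1 - (dT - 1)) (by omega) (by omega) hin).2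
      rwa [show n - 1 - (dT - 1) - 1 = jT by omega] at this
  have hTnW : ¬ω.2.UsesSide ((r.1 : ℤ), Y) .W := by
    rintro ⟨l, hl, hfl, hs⟩
    have el := ω.2.single_visit_of_not_usesSide hTnN hl hjTn hfl hfcT
    subst el
    rw [hTin, hTS] at hs
    rcases hs with hs | hs <;> exact absurd hs (by decide)
  have ht₂nE : ¬ω.2.UsesSide (c₂, Y) .E := by
    rintro ⟨l, hl, hfl, hs⟩
    have hd₂1 : 1 ≤ d₂ := by omega
    obtain ⟨efc, ein⟩ := hrunUp (dT + 1) (by omega) (by push_cast; omega)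
    rw [hj₀T] at efc ein
    have efc' : ω.2.fc (jT - d₂) = (c₂, Y) := by rw [efc]; exact Prod.ext rfl (by push_cast; omega)
    have hprev := hrunTin (d₂ - 1) (by rw [Nat.cast_sub hd₂1]; push_cast; omega)
    rw [show jT - (d₂ - 1) = jT - d₂ + 1 by omega] at hprev
    have hout := (ω.2.fc_pred_eq_of_sIn_E (by omega) (by omega) hprev).2
    rw [show jT - d₂ + 1 - 1 = jT - d₂ by omega] at hout
    have hcN' : ¬ω.2.UsesSide (c₂, Y) .N := by
      rintro ⟨l', hl', hfl', hs'⟩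
      have := hNtop l' hl' (by rw [hfl'])
      rcases hs' with hs' | hs'
      · exact this.1 hs'
      · exact this.2 hs'
    have el := ω.2.single_visit_of_not_usesSide hcN' hl (by omega) hfl efc'
    subst el
    rw [ein, hout] at hs
    rcases hs with hs | hs <;> exact absurd hs (by decide)
  -- a top-row plaquette using `E` or `W` lies between `T` and `t₂`
  have htopE : ∀ c : Face, c.2 = Y → ω.2.UsesSide c .E → r.1 ≤ c.1 ∧ c.1 < c₂ := by
    intro c hcY hu
    obtain ⟨M, hWall, -, hend⟩ := ω.2.chain_E hX' hu
    rcases hend with ⟨hM1, hnot⟩ | ⟨-, hs0⟩ | ⟨-, hsZ⟩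
    · obtain ⟨i', hi', hfc', hsv', -, -, -, hk'⟩ := ω.2.isolated_of_usesSide_not_opp (hWall M hM1 le_rfl) hnot
      have hP' : P (c.1 + M, c.2) := by rw [← hfc']; exact hPiso i' hi' hsv' hk'
      rcases htops _ hP' (by simp only; omega) with e | e
      · -- the end would be `T`, which uses `E`
        exfalso; rw [← e] at hTE; exact hnot hTE
      · rw [ht₂] at e
        have ex := congrArg Prod.fst e; simp only at ex
        refine ⟨?_, by omega⟩
        by_contra hlt'
        push Not at hlt'
        -- `T` strictly inside the chain would use `W`
        obtain ⟨mm, hmm⟩ : ∃ mm : ℕ, (mm : ℤ) = r.1 - c.1 := ⟨(r.1 - c.1).toNat, by omega⟩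
        have := hWall mm (by omega) (by omega)
        rw [show ((c.1 + (mm : ℤ), c.2) : Face) = ((r.1 : ℤ), Y) from Prod.ext (by simp only; omega) (by simp only; omega)] at this
        exact hTnW this
    · exact absurd hs0 h0E
    · rw [hLS] at hsZ; exact absurd hsZ (by decide)
  have htopW : ∀ c : Face, c.2 = Y → ω.2.UsesSide c .W → r.1 < c.1 ∧ c.1 ≤ c₂ := by
    intro c hcY hu
    obtain ⟨M, hEall, -, hend⟩ := ω.2.chain_W hX hu
    rcases hend with ⟨hM1, hnot⟩ | ⟨hA0, -⟩ | ⟨-, hsZ⟩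
    · obtain ⟨i', hi', hfc', hsv', -, -, -, hk'⟩ := ω.2.isolated_of_usesSide_not_opp (hEall M hM1 le_rfl) hnot
      have hP' : P (c.1 - M, c.2) := by rw [← hfc']; exact hPiso i' hi' hsv' hk'
      rcases htops _ hP' (by simp only; omega) with e | e
      · -- the end is `T`
        have ex := congrArg Prod.fst e; simp only at ex
        have hlt1 : r.1 < c.1 := by omega
        have hle2 : c.1 ≤ c₂ := by
          by_contra hlt'
          push Not at hlt'
          -- `t₂` strictly inside the chain would use `E`
          obtain ⟨mm, hmm⟩ : ∃ mm : ℕ, (mm : ℤ) = c.1 - c₂ := ⟨(c.1 - c₂).toNat, by omega⟩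
          have hmm1 : 1 ≤ mm := by omega
          have hmmM : mm ≤ M := by omega
          have := hEall mm hmm1 hmmM
          rw [show ((c.1 - (mm : ℤ), c.2) : Face) = (c₂, Y) from Prod.ext (by simp only; omega) (by simp only; omega)] at this
          exact ht₂nE this
        exact ⟨hlt1, hle2⟩
      · -- the end would be `t₂`, which then uses `E`
        exfalso
        have := hEall M hM1 le_rfl
        rw [e, ht₂] at this
        exact ht₂nE this
    · rw [h0w] at hA0; have := congrArg Prod.snd hA0; simp only at this; omega
    · rw [hLS] at hsZ; exact absurd hsZ (by decide)
  have hhigh : ∀ j < ω.2.firstHitG, (ω.2.fc j).2 ≤ r.2 := by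
    intro j hj
    by_contra hlt
    push Not at hlt
    have hjn : j < n := lt_trans hj hF
    have hle : (ω.2.fc j).2 ≤ Y := hY j hjn
    rcases eq_or_lt_of_le hle with heq | hlt2
    · -- on the top row: a pinned top-row cell
      have hcN : ¬ω.2.UsesSide (ω.2.fc j) .N := by
        rintro ⟨l, hl, hfl, hs⟩
        have := hNtop l hl (by rw [hfl, heq])
        rcases hs with hs | hs
        · exact this.1 hs
        · exact this.2 hs
      have hsvc : ∀ l < n, ω.2.fc l = ω.2.fc j → l = j := fun l hl e => ω.2.single_visit_of_not_usesSide hcN hl hjn e rfl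
      have hcolc : r.1 ≤ (ω.2.fc j).1 ∧ (ω.2.fc j).1 ≤ c₂ := by
        have hne := ω.2.sIn_ne_sOut hjn
        have h1 := (hNtop j hjn heq).1
        have h2 := (hNtop j hjn heq).2
        have key : ∀ s t : Side, s ≠ t → s ≠ .N → t ≠ .N → (s = .E ∨ t = .E) ∨ (s = .W ∨ t = .W) := by decide
        rcases key _ _ hne h1 h2 with hE | hW
        · have := htopE _ heq ⟨j, hjn, rfl, hE⟩; omega
        · have := htopW _ heq ⟨j, hjn, rfl, hW⟩; omega
      obtain ⟨m, hm⟩ : ∃ m : ℕ, (m : ℤ) = (ω.2.fc j).1 - r.1 := ⟨((ω.2.fc j).1 - r.1).toNat, by omega⟩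
      have e := hrunT m (by omega)
      have := hsvc (jT - m) (by omega) (by rw [e]; exact Prod.ext (by simp only; omega) (by simp only; omega))
      omega
    · -- strictly between the row of `r` and the top row: a vertical cell of the descent or of the final climb
      have hk := hvert j hjn (by omega) (by omega) (by omega) (by omega)
      have hcN : ω.2.UsesSide (ω.2.fc j) .N := by
        have key : ∀ s t : Side, arcKind s t = .straight → s ≠ .E → s ≠ .W → (s = .N ∨ t = .N) := by decide
        have hiE : ω.2.sIn j ≠ .E := fun e => by
          rcases hrowE _ ⟨j, hjn, rfl, Or.inl e⟩ with e' | e' | e' | e' <;> omega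
        have hiW : ω.2.sIn j ≠ .W := fun e => by
          rcases hrowW _ ⟨j, hjn, rfl, Or.inl e⟩ with e' | e' | e' | e' <;> omega
        exact ⟨j, hjn, rfl, key _ _ hk hiE hiW⟩
      obtain ⟨M, hSall, -, hend⟩ := ω.2.chain_N hY hcN
      have hcol' : (ω.2.fc j).1 = r.1 ∨ (ω.2.fc j).1 = c₂ := by
        rcases hend with ⟨hM1, hnot⟩ | ⟨-, hs0⟩ | ⟨hZ, -⟩
        · obtain ⟨i', hi', hfc', hsv', -, -, -, hk'⟩ := ω.2.isolated_of_usesSide_not_opp (hSall M hM1 le_rfl) hnot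
          have hP' : P ((ω.2.fc j).1, (ω.2.fc j).2 + M) := by rw [← hfc']; exact hPiso i' hi' hsv' hk'
          have hrow' : ((((ω.2.fc j).1, (ω.2.fc j).2 + M) : Face)).2 = Y := by
            rcases hProw _ hP' with e | e | e | e <;> simp only at e ⊢ <;> omega
          rcases htops _ hP' hrow' with e | e
          · have := congrArg Prod.fst e; simp only at this; exact Or.inl this
          · rw [ht₂] at e; have := congrArg Prod.fst e; simp only at this; exact Or.inr this
        · exact absurd hs0 h0N
        · rw [hL] at hZ; have := congrArg Prod.fst hZ; simp only at this; exact Or.inl this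
      have hsv : ∀ l < n, ω.2.fc l = ω.2.fc j → l = j := by
        intro l hl e
        by_contra hne
        exact (YBWalk.not_straight_of_two_arcs (γ := ω.2) (i := j) (i' := l) hjn hl (Ne.symm hne) e).1 (ω.2.sOut_of_straight hjn hk)
      rcases hcol' with hcw | hce
      · -- the descent: `(r.1, r.2 + 1 + m) = fc (n − 1 − m)`
        obtain ⟨m, hm⟩ : ∃ m : ℕ, (m : ℤ) = (ω.2.fc j).2 - r.2 - 1 := ⟨((ω.2.fc j).2 - r.2 - 1).toNat, by omega⟩
        have e := hdesc m (by omega)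
        have := hsv (n - 1 - m) (by omega) (by rw [e]; exact Prod.ext (by simp only; omega) (by simp only; omega))
        omega
      · -- the final climb: `(c₂, r.2 + m) = fc (j₀ + m)`
        obtain ⟨m, hm⟩ : ∃ m : ℕ, (m : ℤ) = (ω.2.fc j).2 - r.2 := ⟨((ω.2.fc j).2 - r.2).toNat, by omega⟩
        obtain ⟨e, -⟩ := hrunUp m (by omega) (by omega)
        have := hsv (j₀ + m) (by omega) (by rw [e]; exact Prod.ext (by simp only; omega) (by simp only; omega))
        omega
  exact hhigh

/-- ★★ **HOLE COLUMN: THE PREFIX STAYS EAST OF THE HOLE COLUMN.** In the setting of `topClimb_of_cost_seven_straight_holeColumn_above` every arc before the first hit of `r`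
lies in a column `x ≥ w.1`: between the root row and the row of `r` the hole column holds only the hole, `r` itself and plaquettes whose `S`-chain would have no turn to
end at; west of it the prefix would have to cross it (discrete continuity, `YBWalk.exists_fst_eq_between'`).
[cite: GlazmanManolescu2019, §1, Fig. 1 and eq. (1); Lemma 2.1] [cite: CourantRobbins1958, Ch. V Appendix §2 (the even–odd rule)] -/
theorem prefix_col_ge_of_cost_seven_straight_holeColumn_above (hh : holeFaceW w ∉ D) (hr : RootedFace D (w.side .W) r) (h : ω.IsB2a)
    (hA : ω.AJ hr h (toC (midPt (w.side .W))) ≠ 0) (hc : cost (slotOfSide ω.1) ω.2.mids = 7) (hz : ω.1 = .N ∨ ω.1 = .S)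
    (hstr8 : arcKind (ω.2.sIn ω.2.firstHitG) (ω.2.sOut ω.2.firstHitG) = .straight) (hcol : r.1 = w.1 - 1) (habove : w.2 < r.2)
    (hup : ∃ j < ω.2.arcs.length, r.2 < (ω.2.fc j).2) :
    ∀ j < ω.2.firstHitG, w.1 ≤ (ω.2.fc j).1 := by
  classical
  set n := ω.2.arcs.length with hn
  ---------------------------------------------------------------- basics
  have hF := ω.fh_lt h
  have hlen : 0 < n := by omega
  have h0w : ω.2.fc 0 = w := fc_zero_eq_root w hh ω.2 hlen
  have h0W : ω.2.sIn 0 = .W := YBWalk.sIn_zero_eq_W hh ω.2 hlen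
  have h0E : ω.2.sIn 0 ≠ .E := by rw [h0W]; decide
  have h0N : ω.2.sIn 0 ≠ .N := by rw [h0W]; decide
  have h0S : ω.2.sIn 0 ≠ .S := by rw [h0W]; decide
  have hfcF := (fc_fh ω hr h).1
  have hsvr : ∀ l < n, ω.2.fc l = ω.2.fc ω.2.firstHitG → l = ω.2.firstHitG := fun l hl e => eq_firstHitG_of_fc_eq hr h hl e
  have hn1 : n - 1 < n := by omega
  have hwr : r.1 < w.1 := by omega
  ---------------------------------------------------------------- the climb to the top (car 44) with the seven turns
  obtain ⟨c₂, c₁, Y, Y', τ1, k₀, MW, ME, k₁, t₂, hY, hY', hr₃, hY'w, ht₂row, ht₂col, hτ1w, hMW1, hME1, hEW, hWW, hnotW, hWE, hEE, hnotE,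
    hseven, hall, hN1, hL, hLS, hdesc, hdescIn, heWS, heWnN, hlegN, hlegS, hbWnS, hk₁F, hstr, hk₁ns, hfk, hWk, hk₀w, hbotS, hbWnW, hbEnE, hbEnS,
    hinF, houtF, hrunR, hrunL, hrunB, hrunE, hi₀n, hpass, hclimb, hi₁n, ht₂, hTin, hMT, hrunT, hrunTin, htop⟩ :=
    topClimb_of_cost_seven_straight_holeColumn_above hh hr h hA hc hz hstr8 hcol habove hup
  -- hide the disjunctions and the `toNat`-carrying atoms from `omega` until they are rewritten
  have hpassF := Fact.mk hpass
  have htopF := Fact.mk htop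
  have hi₀nF := Fact.mk hi₀n
  have hi₁nF := Fact.mk hi₁n
  have hMTF := Fact.mk hMT
  clear hpass htop hi₀n hi₁n hMT ht₂col
  let P : Face → Prop := fun f => f ∈ facesL ω.2.mids ∧ (kindsL ω.2.mids f = [.corner] ∨ kindsL ω.2.mids f = [.coCorner])
  have hPiso : ∀ k < n, (∀ l < n, ω.2.fc l = ω.2.fc k → l = k) → arcKind (ω.2.sIn k) (ω.2.sOut k) ≠ .straight → P (ω.2.fc k) :=
    fun k hk hsv hkind => isolated_turn hk hsv hkind
  have hmem7 : ∀ f : Face, P f → f = ((r.1 : ℤ), Y) ∨ f = t₂ ∨ f = ((r.1 : ℤ) - MW, Y') ∨ f = (k₀, Y') ∨ f = ((τ1 : ℤ), w.2) ∨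
      f = ((r.1 : ℤ) - MW, r.2) ∨ f = ((r.1 : ℤ) + ME, r.2) := by
    intro f hPf
    have := hall f hPf.1 hPf.2
    simpa only [Finset.mem_insert, Finset.mem_singleton] using this
  have hProw : ∀ f : Face, P f → f.2 = Y ∨ f.2 = Y' ∨ f.2 = w.2 ∨ f.2 = r.2 := by
    intro f hPf
    rcases hmem7 f hPf with rfl | rfl | rfl | rfl | rfl | rfl | rfl
    · exact Or.inl rfl
    · exact Or.inl ht₂row
    · exact Or.inr (Or.inl rfl)
    · exact Or.inr (Or.inl rfl)
    · exact Or.inr (Or.inr (Or.inl rfl))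
    · exact Or.inr (Or.inr (Or.inr rfl))
    · exact Or.inr (Or.inr (Or.inr rfl))
  have hbots : ∀ f : Face, P f → f.2 = Y' → f = ((r.1 : ℤ) - MW, Y') ∨ f = (k₀, Y') := by
    intro f hPf hfY
    rcases hmem7 f hPf with e | e | e | e | e | e | e
    · exfalso; rw [e] at hfY; simp only at hfY; omega
    · exfalso; rw [e, ht₂row] at hfY; omega
    · exact Or.inl e
    · exact Or.inr e
    · exfalso; rw [e] at hfY; simp only at hfY; omega
    · exfalso; rw [e] at hfY; simp only at hfY; omega
    · exfalso; rw [e] at hfY; simp only at hfY; omega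
  have htops : ∀ f : Face, P f → f.2 = Y → f = ((r.1 : ℤ), Y) ∨ f = t₂ := by
    intro f hPf hfY
    rcases hmem7 f hPf with e | e | e | e | e | e | e
    · exact Or.inl e
    · exact Or.inr e
    · exfalso; rw [e] at hfY; simp only at hfY; omega
    · exfalso; rw [e] at hfY; simp only at hfY; omega
    · exfalso; rw [e] at hfY; simp only at hfY; omega
    · exfalso; rw [e] at hfY; simp only at hfY; omega
    · exfalso; rw [e] at hfY; simp only at hfY; omega
  obtain ⟨X', -, hX', -⟩ := exists_right_entry_turn hh hr h
  obtain ⟨X, hXw, hX, -⟩ := exists_left_entry_turn hh hr h hA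
  ---------------------------------------------------------------- rows: a plaquette using `E` or `W` lies on one of the four turn rows
  have hrowE : ∀ c : Face, ω.2.UsesSide c .E → c.2 = Y ∨ c.2 = Y' ∨ c.2 = w.2 ∨ c.2 = r.2 := by
    intro c hcE
    obtain ⟨M, hWall, -, hend⟩ := ω.2.chain_E hX' hcE
    rcases hend with ⟨hM1, hnot⟩ | ⟨-, hs0⟩ | ⟨-, hsZ⟩
    · obtain ⟨i', hi', hfc', hsv', -, -, -, hk'⟩ := ω.2.isolated_of_usesSide_not_opp (hWall M hM1 le_rfl) hnot
      have hP' : P (c.1 + M, c.2) := by rw [← hfc']; exact hPiso i' hi' hsv' hk'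
      have := hProw _ hP'; simp only at this; exact this
    · exact absurd hs0 h0E
    · rw [hLS] at hsZ; exact absurd hsZ (by decide)
  have hrowW : ∀ c : Face, ω.2.UsesSide c .W → c.2 = Y ∨ c.2 = Y' ∨ c.2 = w.2 ∨ c.2 = r.2 := by
    intro c hcW
    obtain ⟨M, hEall, -, hend⟩ := ω.2.chain_W hX hcW
    rcases hend with ⟨hM1, hnot⟩ | ⟨hA0, -⟩ | ⟨-, hsZ⟩
    · obtain ⟨i', hi', hfc', hsv', -, -, -, hk'⟩ := ω.2.isolated_of_usesSide_not_opp (hEall M hM1 le_rfl) hnot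
      have hP' : P (c.1 - M, c.2) := by rw [← hfc']; exact hPiso i' hi' hsv' hk'
      have := hProw _ hP'; simp only at this; exact this
    · rw [h0w] at hA0; have := congrArg Prod.snd hA0; simp only at this; exact Or.inr (Or.inr (Or.inl this))
    · rw [hLS] at hsZ; exact absurd hsZ (by decide)
  have hvert : ∀ i < n, (ω.2.fc i).2 ≠ Y → (ω.2.fc i).2 ≠ Y' → (ω.2.fc i).2 ≠ w.2 → (ω.2.fc i).2 ≠ r.2 →
      arcKind (ω.2.sIn i) (ω.2.sOut i) = .straight := by
    intro i hi h1 h2 h3 h4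
    have hnot : ¬(ω.2.UsesSide (ω.2.fc i) .E ∨ ω.2.UsesSide (ω.2.fc i) .W) := by
      rintro (hu | hu)
      · rcases hrowE _ hu with e | e | e | e
        · exact h1 e
        · exact h2 e
        · exact h3 e
        · exact h4 e
      · rcases hrowW _ hu with e | e | e | e
        · exact h1 e
        · exact h2 e
        · exact h3 e
        · exact h4 e
    have hiE : ω.2.sIn i ≠ .E := fun e => hnot (Or.inl ⟨i, hi, rfl, Or.inl e⟩)
    have hoE : ω.2.sOut i ≠ .E := fun e => hnot (Or.inl ⟨i, hi, rfl, Or.inr e⟩)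
    have hiW : ω.2.sIn i ≠ .W := fun e => hnot (Or.inr ⟨i, hi, rfl, Or.inl e⟩)
    have hoW : ω.2.sOut i ≠ .W := fun e => hnot (Or.inr ⟨i, hi, rfl, Or.inr e⟩)
    have hne := ω.2.sIn_ne_sOut hi
    revert hiE hoE hiW hoW hne
    cases ω.2.sIn i <;> cases ω.2.sOut i <;> decide
  ---------------------------------------------------------------- abbreviations for the pinned indices
  obtain ⟨dB, hdB⟩ : ∃ dB : ℕ, (dB : ℤ) = w.2 - Y' - 1 := ⟨(w.2 - Y' - 1).toNat, by omega⟩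
  obtain ⟨dR, hdR⟩ : ∃ dR : ℕ, (dR : ℤ) = k₀ - (r.1 - MW) - 1 := ⟨(k₀ - (r.1 - MW) - 1).toNat, by omega⟩
  obtain ⟨dL, hdL⟩ : ∃ dL : ℕ, (dL : ℤ) = r.2 - Y' - 1 := ⟨(r.2 - Y' - 1).toNat, by omega⟩
  obtain ⟨dM, hdM⟩ : ∃ dM : ℕ, (dM : ℤ) = r.2 - w.2 - 1 := ⟨(r.2 - w.2 - 1).toNat, by omega⟩
  obtain ⟨dT, hdT⟩ : ∃ dT : ℕ, (dT : ℤ) = Y - r.2 - 1 := ⟨(Y - r.2 - 1).toNat, by omega⟩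
  have htoNat : ∀ (a : ℤ) (k : ℕ), a = k → a.toNat = k := fun a k e => by subst e; exact Int.toNat_natCast k
  set x₁ : ℤ := w.1 + k₁ with hx₁def
  have hc₁x : x₁ < c₁ := by rcases hpassF.out with ⟨e1, e2, e3, -⟩ | ⟨e1, -, e3, -⟩ <;> omega
  have hc₂ : c₂ = c₁ ∨ c₂ = x₁ := by rcases htopF.out with ⟨e, -⟩ | ⟨e, -⟩ <;> [exact Or.inl e; exact Or.inr e]
  have hc₂r : r.1 < c₂ := by rcases hc₂ with e | e <;> omega
  have hc₂F := Fact.mk hc₂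
  clear hc₂
  obtain ⟨dC, hdC⟩ : ∃ dC : ℕ, (dC : ℤ) = c₁ - k₀ := ⟨(c₁ - k₀).toNat, by rcases hpassF.out with ⟨e1, e2, e3, -⟩ | ⟨e1, -, e3, -⟩ <;> omega⟩
  obtain ⟨dH, hdH⟩ : ∃ dH : ℕ, (dH : ℤ) = c₁ - x₁ - 1 := ⟨(c₁ - x₁ - 1).toNat, by omega⟩
  obtain ⟨d₂, hd₂⟩ : ∃ d₂ : ℕ, (d₂ : ℤ) = c₂ - r.1 := ⟨(c₂ - r.1).toNat, by omega⟩
  obtain ⟨jB, hjB⟩ : ∃ jB : ℕ, ω.2.firstHitG + MW + (dL + 1) = jB := ⟨_, rfl⟩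
  obtain ⟨jE, hjE⟩ : ∃ jE : ℕ, jB + (dR + 1) = jE := ⟨_, rfl⟩
  obtain ⟨i₀, hi₀⟩ : ∃ i₀ : ℕ, jE + (dB + 1) = i₀ := ⟨_, rfl⟩
  obtain ⟨iC, hiC⟩ : ∃ iC : ℕ, i₀ + dC = iC := ⟨_, rfl⟩
  obtain ⟨i₁, hi₁⟩ : ∃ i₁ : ℕ, iC + (dM + 1) = i₁ := ⟨_, rfl⟩
  obtain ⟨jT, hjT⟩ : ∃ jT : ℕ, n - 1 - dT = jT := ⟨_, rfl⟩
  have eLF : Fact ((r.2 - Y').toNat = dL + 1) := ⟨htoNat _ _ (by push_cast; omega)⟩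
  have eRF : Fact ((k₀ - (r.1 - MW)).toNat = dR + 1) := ⟨htoNat _ _ (by push_cast; omega)⟩
  have eBF : Fact ((w.2 - Y').toNat = dB + 1) := ⟨htoNat _ _ (by push_cast; omega)⟩
  have eCF : Fact ((c₁ - k₀).toNat = dC) := ⟨htoNat _ _ (by omega)⟩
  have eMF : Fact ((r.2 - w.2).toNat = dM + 1) := ⟨htoNat _ _ (by push_cast; omega)⟩
  have eTF : Fact ((Y - r.2 - 1).toNat = dT) := ⟨htoNat _ _ (by omega)⟩
  have eT1F : Fact ((Y - r.2).toNat = dT + 1) := ⟨htoNat _ _ (by push_cast; omega)⟩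
  have e₂F : Fact ((c₂ - r.1).toNat = d₂) := ⟨htoNat _ _ (by omega)⟩
  have eHF : Fact ((c₁ - (w.1 + (k₁ : ℤ))).toNat = dH + 1) := ⟨htoNat _ _ (by push_cast; omega)⟩
  have hIDX0F : Fact (ω.2.firstHitG + MW + (r.2 - Y').toNat + (k₀ - (r.1 - MW)).toNat + (w.2 - Y').toNat = i₀) :=
    ⟨by rw [eLF.out, eRF.out, eBF.out]; omega⟩
  have hIDX1F : Fact (ω.2.firstHitG + MW + (r.2 - Y').toNat + (k₀ - (r.1 - MW)).toNat + (w.2 - Y').toNat + (c₁ - k₀).toNat +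
      (r.2 - w.2).toNat = i₁) := ⟨by rw [eLF.out, eRF.out, eBF.out, eCF.out, eMF.out]; omega⟩
  have hTOPF : Fact (n - 1 - (Y - r.2 - 1).toNat = jT) := ⟨by rw [eTF.out]; exact hjT⟩
  rw [eLF.out] at hrunB
  rw [eLF.out, eRF.out] at hrunE
  have hi₀n := hi₀nF.out
  rw [hIDX0F.out] at hi₀n
  rw [hIDX0F.out, eCF.out] at hclimb
  have hi₁n := hi₁nF.out
  rw [hIDX1F.out] at hi₁n
  have hMT := hMTF.out
  rw [hTOPF.out, e₂F.out] at hMT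
  rw [hTOPF.out] at hTin hrunT hrunTin
  rw [hjB] at hrunB hrunE
  rw [hjE] at hrunE
  rw [show i₀ + dC = iC from hiC] at hclimb
  clear hi₀nF hi₁nF hMTF
  have hiC₀ : i₀ ≤ iC := by omega
  have hFi₀ : ω.2.firstHitG < i₀ := by omega
  have hjTn : jT < n := by omega
  have hNtop := forall_top_ne_N hh hr h hY (by omega)
  have hfcT : ω.2.fc jT = (r.1, Y) := by have := hrunT 0 (by omega); rwa [Nat.sub_zero, Nat.cast_zero, add_zero] at this
  have hlow := prefix_row_ge_of_cost_seven_straight_holeColumn_above hh hr h hA hc hz hstr8 hcol habove hup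
  have hhigh := prefix_row_le_of_cost_seven_straight_holeColumn_above hh hr h hA hc hz hstr8 hcol habove hup
  ---------------------------------------------------------------- (P3) no prefix arc in the hole column or west of it
  have hmemD : ∀ {c : Face} {s : Side}, ω.2.UsesSide c s → c ∈ D := by
    intro c s hu
    obtain ⟨j, hj, hfj⟩ := ω.2.exists_fc_eq_of_usesSide hu
    rw [← hfj]; exact (YBWalk.arcFace_arcAt hj).2
  have hholeCol : ∀ j < ω.2.firstHitG, (ω.2.fc j).1 ≠ r.1 := by
    intro j hj hcj
    have hjn : j < n := lt_trans hj hF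
    have h1 := hlow j hj
    have h2 := hhigh j hj
    rcases eq_or_lt_of_le h1 with heq | hgt
    · -- the hole itself
      have hD := (YBWalk.arcFace_arcAt hjn).2
      exact hh (by rw [show holeFaceW w = ω.2.fc j from Prod.ext (by simp [holeFaceW]; omega) (by simp [holeFaceW]; omega)]; exact hD)
    rcases eq_or_lt_of_le h2 with heq2 | hlt2
    · -- `r` itself
      have := hsvr j hjn (by rw [hfcF]; exact Prod.ext hcj heq2)
      omega
    · -- strictly between: a vertical cell whose `S`-chain has nowhere to end
      have hk := hvert j hjn (by omega) (by omega) (by omega) (by omega)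
      have hcS : ω.2.UsesSide (ω.2.fc j) .S := by
        have key : ∀ s t : Side, arcKind s t = .straight → s ≠ .E → s ≠ .W → (s = .S ∨ t = .S) := by decide
        have hiE : ω.2.sIn j ≠ .E := fun e => by
          rcases hrowE _ ⟨j, hjn, rfl, Or.inl e⟩ with e' | e' | e' | e' <;> omega
        have hiW : ω.2.sIn j ≠ .W := fun e => by
          rcases hrowW _ ⟨j, hjn, rfl, Or.inl e⟩ with e' | e' | e' | e' <;> omega
        exact ⟨j, hjn, rfl, key _ _ hk hiE hiW⟩
      obtain ⟨M, hNall, -, hend⟩ := ω.2.chain_S hY' hcS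
      rcases hend with ⟨hM1, hnot⟩ | ⟨hA0, -⟩ | ⟨hZ, -⟩
      · obtain ⟨i', hi', hfc', hsv', -, -, -, hk'⟩ := ω.2.isolated_of_usesSide_not_opp (hNall M hM1 le_rfl) hnot
        have hP' : P ((ω.2.fc j).1, (ω.2.fc j).2 - M) := by rw [← hfc']; exact hPiso i' hi' hsv' hk'
        rcases hmem7 _ hP' with e | e | e | e | e | e | e
        · have := congrArg Prod.snd e; simp only at this; omega
        · rw [ht₂] at e; have := congrArg Prod.snd e; simp only at this; omega
        · have := congrArg Prod.fst e; simp only at this; omega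
        · have := congrArg Prod.fst e; simp only at this; omega
        · have := congrArg Prod.fst e; simp only at this; omega
        · have := congrArg Prod.fst e; simp only at this; omega
        · have := congrArg Prod.fst e; simp only at this; omega
      · rw [h0w] at hA0; have := congrArg Prod.fst hA0; simp only at this; omega
      · rw [hL] at hZ; have := congrArg Prod.snd hZ; simp only at this; omega
  have hwest : ∀ j < ω.2.firstHitG, w.1 ≤ (ω.2.fc j).1 := by
    intro j hj
    by_contra hlt
    push Not at hlt
    obtain ⟨l, -, hlj, hl⟩ := ω.2.exists_fst_eq_between' (i := 0) (j := j) (Nat.zero_le _) (by omega) (x := r.1)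
      (by rw [h0w]; omega) (by omega)
    exact hholeCol l (by omega) hl
  exact hwest
set_option maxHeartbeats 400000 in -- buildfix (bf3-g30): 160k/180k FAIL, 200k PASS at accept time; line-neutral budget line
/-- ★★★ **HOLE COLUMN: THE PREFIX IS THE HOOK.** In the setting of `topClimb_of_cost_seven_straight_holeColumn_above` the prefix is forced: `p₁ = (x₁, w.2)` is left
through `N`, the column `x₁` is climbed straight to the hook plaquette `h = (x₁, r.2)`, which is left through `W`, and the row of `r` is followed straight into `r`, so
`F = 2k₁ + 1 + (r.2 − w.2)`; without the hook kiss (`c₂ = c₁`) the hook is `e_E` (`ME = k₁ + 1`), `h` does not use `E` and the climb cell `(c₁, r.2)` does not use `W`.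
[cite: GlazmanManolescu2019, §1, Fig. 1 and eq. (1); Lemma 2.1; Remark 2.2] [cite: Glazman2015WeightedSAW, Lemma 3.1 (proof, pp. 6–7)] [cite: CourantRobbins1958,
Ch. V Appendix §2 (the even–odd rule)] -/
theorem hookPrefix_of_cost_seven_straight_holeColumn_above (hh : holeFaceW w ∉ D) (hr : RootedFace D (w.side .W) r) (h : ω.IsB2a)
    (hA : ω.AJ hr h (toC (midPt (w.side .W))) ≠ 0) (hc : cost (slotOfSide ω.1) ω.2.mids = 7) (hz : ω.1 = .N ∨ ω.1 = .S)
    (hstr8 : arcKind (ω.2.sIn ω.2.firstHitG) (ω.2.sOut ω.2.firstHitG) = .straight) (hcol : r.1 = w.1 - 1) (habove : w.2 < r.2)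
    (hup : ∃ j < ω.2.arcs.length, r.2 < (ω.2.fc j).2) :
    ∃ (c₂ : ℤ), ∃ (c₁ : ℤ), ∃ (Y Y' τ1 k₀ : ℤ) (MW ME k₁ : ℕ) (t₂ : Face),
      (∀ j < ω.2.arcs.length, (ω.2.fc j).2 ≤ Y) ∧ (∀ j < ω.2.arcs.length, Y' ≤ (ω.2.fc j).2) ∧ r.2 < Y ∧ Y' < w.2 ∧
      t₂.2 = Y ∧ t₂.1 ≠ r.1 ∧ w.1 ≤ τ1 ∧ 1 ≤ MW ∧ 1 ≤ ME ∧
      (∀ m : ℕ, 1 ≤ m → m ≤ MW → ω.2.UsesSide (r.1 - m, r.2) .E) ∧ (∀ m : ℕ, m < MW → ω.2.UsesSide (r.1 - m, r.2) .W) ∧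
        ¬ω.2.UsesSide (r.1 - MW, r.2) .W ∧
      (∀ m : ℕ, 1 ≤ m → m ≤ ME → ω.2.UsesSide (r.1 + m, r.2) .W) ∧ (∀ m : ℕ, m < ME → ω.2.UsesSide (r.1 + m, r.2) .E) ∧
        ¬ω.2.UsesSide (r.1 + ME, r.2) .E ∧
      (∀ f ∈ ({((r.1 : ℤ), Y), t₂, ((r.1 : ℤ) - MW, Y'), (k₀, Y'), ((τ1 : ℤ), w.2), ((r.1 : ℤ) - MW, r.2), ((r.1 : ℤ) + ME, r.2)} : Finset Face),
        f ∈ facesL ω.2.mids ∧ (kindsL ω.2.mids f = [.corner] ∨ kindsL ω.2.mids f = [.coCorner])) ∧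
      (∀ f : Face, f ∈ facesL ω.2.mids → (kindsL ω.2.mids f = [.corner] ∨ kindsL ω.2.mids f = [.coCorner]) →
        f ∈ ({((r.1 : ℤ), Y), t₂, ((r.1 : ℤ) - MW, Y'), (k₀, Y'), ((τ1 : ℤ), w.2), ((r.1 : ℤ) - MW, r.2), ((r.1 : ℤ) + ME, r.2)} : Finset Face)) ∧
      ω.1 = .N ∧ ω.2.fc (ω.2.arcs.length - 1) = (r.1, r.2 + 1) ∧ ω.2.sOut (ω.2.arcs.length - 1) = .S ∧
      (∀ m : ℕ, (m : ℤ) ≤ Y - r.2 - 1 → ω.2.fc (ω.2.arcs.length - 1 - m) = (r.1, r.2 + 1 + m)) ∧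
      (∀ m : ℕ, (m : ℤ) < Y - r.2 - 1 → ω.2.sIn (ω.2.arcs.length - 1 - m) = .N) ∧
      ω.2.UsesSide (r.1 - MW, r.2) .S ∧ ¬ω.2.UsesSide (r.1 - MW, r.2) .N ∧
      (∀ m : ℕ, 1 ≤ m → (m : ℤ) ≤ r.2 - Y' → ω.2.UsesSide (r.1 - MW, r.2 - m) .N) ∧
      (∀ m : ℕ, (m : ℤ) < r.2 - Y' → ω.2.UsesSide (r.1 - MW, r.2 - m) .S) ∧ ¬ω.2.UsesSide (r.1 - MW, Y') .S ∧
      -- new in this car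
      k₁ ≤ ω.2.firstHitG ∧ (∀ j < k₁, arcKind (ω.2.sIn j) (ω.2.sOut j) = .straight) ∧ arcKind (ω.2.sIn k₁) (ω.2.sOut k₁) ≠ .straight ∧
      ω.2.fc k₁ = (w.1 + k₁, w.2) ∧ ω.2.sIn k₁ = .W ∧ w.1 + k₁ ≤ k₀ ∧
      (∀ x : ℤ, ¬ω.2.UsesSide (x, Y') .S) ∧ ¬ω.2.UsesSide (r.1 - MW, Y') .W ∧ ¬ω.2.UsesSide (k₀, Y') .E ∧ ¬ω.2.UsesSide (k₀, Y') .S ∧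
      ω.2.sIn ω.2.firstHitG = .E ∧ ω.2.sOut ω.2.firstHitG = .W ∧
      (∀ m : ℕ, m ≤ MW → ω.2.fc (ω.2.firstHitG + m) = (r.1 - m, r.2) ∧ ω.2.sIn (ω.2.firstHitG + m) = .E) ∧
      (∀ m : ℕ, 1 ≤ m → (m : ℤ) ≤ r.2 - Y' → ω.2.fc (ω.2.firstHitG + MW + m) = (r.1 - MW, r.2 - m) ∧ ω.2.sIn (ω.2.firstHitG + MW + m) = .N) ∧
      (∀ m : ℕ, 1 ≤ m → (m : ℤ) ≤ k₀ - (r.1 - MW) →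
        ω.2.fc (ω.2.firstHitG + MW + (r.2 - Y').toNat + m) = (r.1 - MW + m, Y') ∧ ω.2.sIn (ω.2.firstHitG + MW + (r.2 - Y').toNat + m) = .W) ∧
      (∀ m : ℕ, 1 ≤ m → (m : ℤ) ≤ w.2 - Y' →
        ω.2.fc (ω.2.firstHitG + MW + (r.2 - Y').toNat + (k₀ - (r.1 - MW)).toNat + m) = (k₀, Y' + m) ∧
          ω.2.sIn (ω.2.firstHitG + MW + (r.2 - Y').toNat + (k₀ - (r.1 - MW)).toNat + m) = .S) ∧
      ω.2.firstHitG + MW + (r.2 - Y').toNat + (k₀ - (r.1 - MW)).toNat + (w.2 - Y').toNat < ω.2.arcs.length ∧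
      -- new in this car: the root-row passage and the climb to the row of `r`
      ((k₀ = w.1 + k₁ ∧ w.1 + k₁ < τ1 ∧ c₁ = τ1 ∧ ω.2.sOut k₁ = .N ∧
          ω.2.sOut (ω.2.firstHitG + MW + (r.2 - Y').toNat + (k₀ - (r.1 - MW)).toNat + (w.2 - Y').toNat) = .E ∧
          (∀ m : ℕ, 1 ≤ m → (m : ℤ) ≤ τ1 - (w.1 + k₁) →
            ω.2.fc (ω.2.firstHitG + MW + (r.2 - Y').toNat + (k₀ - (r.1 - MW)).toNat + (w.2 - Y').toNat + m) = (w.1 + k₁ + m, w.2) ∧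
            ω.2.sIn (ω.2.firstHitG + MW + (r.2 - Y').toNat + (k₀ - (r.1 - MW)).toNat + (w.2 - Y').toNat + m) = .W) ∧
          ω.2.sOut (ω.2.firstHitG + MW + (r.2 - Y').toNat + (k₀ - (r.1 - MW)).toNat + (w.2 - Y').toNat + (τ1 - (w.1 + k₁)).toNat) = .N) ∨
        (w.1 + k₁ < k₀ ∧ τ1 = w.1 + k₁ ∧ c₁ = k₀ ∧ ¬ω.2.UsesSide (w.1 + k₁, w.2) .S ∧ ¬ω.2.UsesSide (w.1 + k₁, w.2) .E ∧ ¬ω.2.UsesSide (k₀, w.2) .W ∧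
          ω.2.sOut (ω.2.firstHitG + MW + (r.2 - Y').toNat + (k₀ - (r.1 - MW)).toNat + (w.2 - Y').toNat) = .N)) ∧
      (∀ m : ℕ, 1 ≤ m → (m : ℤ) ≤ r.2 - w.2 →
        ω.2.fc (ω.2.firstHitG + MW + (r.2 - Y').toNat + (k₀ - (r.1 - MW)).toNat + (w.2 - Y').toNat + (c₁ - k₀).toNat + m) = (c₁, w.2 + m) ∧
          ω.2.sIn (ω.2.firstHitG + MW + (r.2 - Y').toNat + (k₀ - (r.1 - MW)).toNat + (w.2 - Y').toNat + (c₁ - k₀).toNat + m) = .S) ∧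
      ω.2.firstHitG + MW + (r.2 - Y').toNat + (k₀ - (r.1 - MW)).toNat + (w.2 - Y').toNat + (c₁ - k₀).toNat + (r.2 - w.2).toNat < ω.2.arcs.length ∧
      -- new in this car: the climb to the top row and the top row into `T`
      t₂ = (c₂, Y) ∧ ω.2.sIn (ω.2.arcs.length - 1 - (Y - r.2 - 1).toNat) = .E ∧ (c₂ - r.1).toNat ≤ ω.2.arcs.length - 1 - (Y - r.2 - 1).toNat ∧
      (∀ m : ℕ, (m : ℤ) ≤ c₂ - r.1 → ω.2.fc (ω.2.arcs.length - 1 - (Y - r.2 - 1).toNat - m) = (r.1 + m, Y)) ∧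
      (∀ m : ℕ, (m : ℤ) < c₂ - r.1 → ω.2.sIn (ω.2.arcs.length - 1 - (Y - r.2 - 1).toNat - m) = .E) ∧
      ((c₂ = c₁ ∧ ω.2.sOut (ω.2.firstHitG + MW + (r.2 - Y').toNat + (k₀ - (r.1 - MW)).toNat + (w.2 - Y').toNat + (c₁ - k₀).toNat + (r.2 - w.2).toNat) = .N ∧
          (∀ m : ℕ, 1 ≤ m → (m : ℤ) ≤ Y - r.2 → ω.2.fc (ω.2.firstHitG + MW + (r.2 - Y').toNat + (k₀ - (r.1 - MW)).toNat + (w.2 - Y').toNat + (c₁ - k₀).toNat + (r.2 - w.2).toNat + m) = (c₁, r.2 + m) ∧ ω.2.sIn (ω.2.firstHitG + MW + (r.2 - Y').toNat + (k₀ - (r.1 - MW)).toNat + (w.2 - Y').toNat + (c₁ - k₀).toNat + (r.2 - w.2).toNat + m) = .S) ∧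
          ω.2.firstHitG + MW + (r.2 - Y').toNat + (k₀ - (r.1 - MW)).toNat + (w.2 - Y').toNat + (c₁ - k₀).toNat + (r.2 - w.2).toNat + (Y - r.2).toNat = ω.2.arcs.length - 1 - (Y - r.2 - 1).toNat - (c₂ - r.1).toNat) ∨
        (c₂ = w.1 + k₁ ∧ (ME : ℤ) = c₁ - r.1 ∧ ω.2.sOut (ω.2.firstHitG + MW + (r.2 - Y').toNat + (k₀ - (r.1 - MW)).toNat + (w.2 - Y').toNat + (c₁ - k₀).toNat + (r.2 - w.2).toNat) = .W ∧
          (∀ m : ℕ, 1 ≤ m → (m : ℤ) ≤ c₁ - (w.1 + k₁) → ω.2.fc (ω.2.firstHitG + MW + (r.2 - Y').toNat + (k₀ - (r.1 - MW)).toNat + (w.2 - Y').toNat + (c₁ - k₀).toNat + (r.2 - w.2).toNat + m) = (c₁ - m, r.2) ∧ ω.2.sIn (ω.2.firstHitG + MW + (r.2 - Y').toNat + (k₀ - (r.1 - MW)).toNat + (w.2 - Y').toNat + (c₁ - k₀).toNat + (r.2 - w.2).toNat + m) = .E) ∧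
          ω.2.sOut (ω.2.firstHitG + MW + (r.2 - Y').toNat + (k₀ - (r.1 - MW)).toNat + (w.2 - Y').toNat + (c₁ - k₀).toNat + (r.2 - w.2).toNat + (c₁ - (w.1 + k₁)).toNat) = .N ∧
          (∀ m : ℕ, 1 ≤ m → (m : ℤ) ≤ Y - r.2 →
            ω.2.fc (ω.2.firstHitG + MW + (r.2 - Y').toNat + (k₀ - (r.1 - MW)).toNat + (w.2 - Y').toNat + (c₁ - k₀).toNat + (r.2 - w.2).toNat + (c₁ - (w.1 + k₁)).toNat + m) = (w.1 + k₁, r.2 + m) ∧ ω.2.sIn (ω.2.firstHitG + MW + (r.2 - Y').toNat + (k₀ - (r.1 - MW)).toNat + (w.2 - Y').toNat + (c₁ - k₀).toNat + (r.2 - w.2).toNat + (c₁ - (w.1 + k₁)).toNat + m) = .S) ∧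
          ω.2.firstHitG + MW + (r.2 - Y').toNat + (k₀ - (r.1 - MW)).toNat + (w.2 - Y').toNat + (c₁ - k₀).toNat + (r.2 - w.2).toNat + (c₁ - (w.1 + k₁)).toNat + (Y - r.2).toNat = ω.2.arcs.length - 1 - (Y - r.2 - 1).toNat - (c₂ - r.1).toNat)) ∧
      -- new in this car: the prefix (the hook)
      ω.2.sOut k₁ = .N ∧
      (∀ m : ℕ, 1 ≤ m → (m : ℤ) ≤ r.2 - w.2 → ω.2.fc (k₁ + m) = (w.1 + k₁, w.2 + m) ∧ ω.2.sIn (k₁ + m) = .S) ∧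
      ω.2.sOut (k₁ + (r.2 - w.2).toNat) = .W ∧
      (∀ m : ℕ, 1 ≤ m → m ≤ k₁ + 1 → ω.2.fc (k₁ + (r.2 - w.2).toNat + m) = (w.1 + k₁ - m, r.2) ∧ ω.2.sIn (k₁ + (r.2 - w.2).toNat + m) = .E) ∧
      ω.2.firstHitG = k₁ + (r.2 - w.2).toNat + k₁ + 1 ∧
      (c₂ = c₁ → (ME : ℤ) = k₁ + 1) ∧
      (c₂ = c₁ → ¬ω.2.UsesSide (w.1 + k₁, r.2) .E) ∧ (c₂ = c₁ → ¬ω.2.UsesSide (c₁, r.2) .W) := by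
  classical
  set n := ω.2.arcs.length with hn
  ---------------------------------------------------------------- basics
  have hF := ω.fh_lt h
  have hlen : 0 < n := by omega
  have h0w : ω.2.fc 0 = w := fc_zero_eq_root w hh ω.2 hlen
  have h0W : ω.2.sIn 0 = .W := YBWalk.sIn_zero_eq_W hh ω.2 hlen
  have h0E : ω.2.sIn 0 ≠ .E := by rw [h0W]; decide
  have h0N : ω.2.sIn 0 ≠ .N := by rw [h0W]; decide
  have h0S : ω.2.sIn 0 ≠ .S := by rw [h0W]; decide
  have hfcF := (fc_fh ω hr h).1
  have hsvr : ∀ l < n, ω.2.fc l = ω.2.fc ω.2.firstHitG → l = ω.2.firstHitG := fun l hl e => eq_firstHitG_of_fc_eq hr h hl e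
  have hn1 : n - 1 < n := by omega
  have hwr : r.1 < w.1 := by omega
  ---------------------------------------------------------------- the climb to the top (car 44) with the seven turns
  obtain ⟨c₂, c₁, Y, Y', τ1, k₀, MW, ME, k₁, t₂, hY, hY', hr₃, hY'w, ht₂row, ht₂col, hτ1w, hMW1, hME1, hEW, hWW, hnotW, hWE, hEE, hnotE,
    hseven, hall, hN1, hL, hLS, hdesc, hdescIn, heWS, heWnN, hlegN, hlegS, hbWnS, hk₁F, hstr, hk₁ns, hfk, hWk, hk₀w, hbotS, hbWnW, hbEnE, hbEnS,
    hinF, houtF, hrunR, hrunL, hrunB, hrunE, hi₀n, hpass, hclimb, hi₁n, ht₂, hTin, hMT, hrunT, hrunTin, htop⟩ :=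
    topClimb_of_cost_seven_straight_holeColumn_above hh hr h hA hc hz hstr8 hcol habove hup
  -- hide the disjunctions and the `toNat`-carrying atoms from `omega` until they are rewritten
  have hpassF := Fact.mk hpass
  have htopF := Fact.mk htop
  have hi₀nF := Fact.mk hi₀n
  have hi₁nF := Fact.mk hi₁n
  have hMTF := Fact.mk hMT
  clear hpass htop hi₀n hi₁n hMT ht₂col
  let P : Face → Prop := fun f => f ∈ facesL ω.2.mids ∧ (kindsL ω.2.mids f = [.corner] ∨ kindsL ω.2.mids f = [.coCorner])
  have hPiso : ∀ k < n, (∀ l < n, ω.2.fc l = ω.2.fc k → l = k) → arcKind (ω.2.sIn k) (ω.2.sOut k) ≠ .straight → P (ω.2.fc k) :=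
    fun k hk hsv hkind => isolated_turn hk hsv hkind
  have hmem7 : ∀ f : Face, P f → f = ((r.1 : ℤ), Y) ∨ f = t₂ ∨ f = ((r.1 : ℤ) - MW, Y') ∨ f = (k₀, Y') ∨ f = ((τ1 : ℤ), w.2) ∨
      f = ((r.1 : ℤ) - MW, r.2) ∨ f = ((r.1 : ℤ) + ME, r.2) := by
    intro f hPf
    have := hall f hPf.1 hPf.2
    simpa only [Finset.mem_insert, Finset.mem_singleton] using this
  have hProw : ∀ f : Face, P f → f.2 = Y ∨ f.2 = Y' ∨ f.2 = w.2 ∨ f.2 = r.2 := by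
    intro f hPf
    rcases hmem7 f hPf with rfl | rfl | rfl | rfl | rfl | rfl | rfl
    · exact Or.inl rfl
    · exact Or.inl ht₂row
    · exact Or.inr (Or.inl rfl)
    · exact Or.inr (Or.inl rfl)
    · exact Or.inr (Or.inr (Or.inl rfl))
    · exact Or.inr (Or.inr (Or.inr rfl))
    · exact Or.inr (Or.inr (Or.inr rfl))
  have hbots : ∀ f : Face, P f → f.2 = Y' → f = ((r.1 : ℤ) - MW, Y') ∨ f = (k₀, Y') := by
    intro f hPf hfY
    rcases hmem7 f hPf with e | e | e | e | e | e | e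
    · exfalso; rw [e] at hfY; simp only at hfY; omega
    · exfalso; rw [e, ht₂row] at hfY; omega
    · exact Or.inl e
    · exact Or.inr e
    · exfalso; rw [e] at hfY; simp only at hfY; omega
    · exfalso; rw [e] at hfY; simp only at hfY; omega
    · exfalso; rw [e] at hfY; simp only at hfY; omega
  have htops : ∀ f : Face, P f → f.2 = Y → f = ((r.1 : ℤ), Y) ∨ f = t₂ := by
    intro f hPf hfY
    rcases hmem7 f hPf with e | e | e | e | e | e | e
    · exact Or.inl e
    · exact Or.inr e
    · exfalso; rw [e] at hfY; simp only at hfY; omega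
    · exfalso; rw [e] at hfY; simp only at hfY; omega
    · exfalso; rw [e] at hfY; simp only at hfY; omega
    · exfalso; rw [e] at hfY; simp only at hfY; omega
    · exfalso; rw [e] at hfY; simp only at hfY; omega
  obtain ⟨X', -, hX', -⟩ := exists_right_entry_turn hh hr h
  obtain ⟨X, hXw, hX, -⟩ := exists_left_entry_turn hh hr h hA
  ---------------------------------------------------------------- rows: a plaquette using `E` or `W` lies on one of the four turn rows
  have hrowE : ∀ c : Face, ω.2.UsesSide c .E → c.2 = Y ∨ c.2 = Y' ∨ c.2 = w.2 ∨ c.2 = r.2 := by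
    intro c hcE
    obtain ⟨M, hWall, -, hend⟩ := ω.2.chain_E hX' hcE
    rcases hend with ⟨hM1, hnot⟩ | ⟨-, hs0⟩ | ⟨-, hsZ⟩
    · obtain ⟨i', hi', hfc', hsv', -, -, -, hk'⟩ := ω.2.isolated_of_usesSide_not_opp (hWall M hM1 le_rfl) hnot
      have hP' : P (c.1 + M, c.2) := by rw [← hfc']; exact hPiso i' hi' hsv' hk'
      have := hProw _ hP'; simp only at this; exact this
    · exact absurd hs0 h0E
    · rw [hLS] at hsZ; exact absurd hsZ (by decide)
  have hrowW : ∀ c : Face, ω.2.UsesSide c .W → c.2 = Y ∨ c.2 = Y' ∨ c.2 = w.2 ∨ c.2 = r.2 := by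
    intro c hcW
    obtain ⟨M, hEall, -, hend⟩ := ω.2.chain_W hX hcW
    rcases hend with ⟨hM1, hnot⟩ | ⟨hA0, -⟩ | ⟨-, hsZ⟩
    · obtain ⟨i', hi', hfc', hsv', -, -, -, hk'⟩ := ω.2.isolated_of_usesSide_not_opp (hEall M hM1 le_rfl) hnot
      have hP' : P (c.1 - M, c.2) := by rw [← hfc']; exact hPiso i' hi' hsv' hk'
      have := hProw _ hP'; simp only at this; exact this
    · rw [h0w] at hA0; have := congrArg Prod.snd hA0; simp only at this; exact Or.inr (Or.inr (Or.inl this))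
    · rw [hLS] at hsZ; exact absurd hsZ (by decide)
  have hvert : ∀ i < n, (ω.2.fc i).2 ≠ Y → (ω.2.fc i).2 ≠ Y' → (ω.2.fc i).2 ≠ w.2 → (ω.2.fc i).2 ≠ r.2 →
      arcKind (ω.2.sIn i) (ω.2.sOut i) = .straight := by
    intro i hi h1 h2 h3 h4
    have hnot : ¬(ω.2.UsesSide (ω.2.fc i) .E ∨ ω.2.UsesSide (ω.2.fc i) .W) := by
      rintro (hu | hu)
      · rcases hrowE _ hu with e | e | e | e
        · exact h1 e
        · exact h2 e
        · exact h3 e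
        · exact h4 e
      · rcases hrowW _ hu with e | e | e | e
        · exact h1 e
        · exact h2 e
        · exact h3 e
        · exact h4 e
    have hiE : ω.2.sIn i ≠ .E := fun e => hnot (Or.inl ⟨i, hi, rfl, Or.inl e⟩)
    have hoE : ω.2.sOut i ≠ .E := fun e => hnot (Or.inl ⟨i, hi, rfl, Or.inr e⟩)
    have hiW : ω.2.sIn i ≠ .W := fun e => hnot (Or.inr ⟨i, hi, rfl, Or.inl e⟩)
    have hoW : ω.2.sOut i ≠ .W := fun e => hnot (Or.inr ⟨i, hi, rfl, Or.inr e⟩)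
    have hne := ω.2.sIn_ne_sOut hi
    revert hiE hoE hiW hoW hne
    cases ω.2.sIn i <;> cases ω.2.sOut i <;> decide
  ---------------------------------------------------------------- abbreviations for the pinned indices
  obtain ⟨dB, hdB⟩ : ∃ dB : ℕ, (dB : ℤ) = w.2 - Y' - 1 := ⟨(w.2 - Y' - 1).toNat, by omega⟩
  obtain ⟨dR, hdR⟩ : ∃ dR : ℕ, (dR : ℤ) = k₀ - (r.1 - MW) - 1 := ⟨(k₀ - (r.1 - MW) - 1).toNat, by omega⟩
  obtain ⟨dL, hdL⟩ : ∃ dL : ℕ, (dL : ℤ) = r.2 - Y' - 1 := ⟨(r.2 - Y' - 1).toNat, by omega⟩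
  obtain ⟨dM, hdM⟩ : ∃ dM : ℕ, (dM : ℤ) = r.2 - w.2 - 1 := ⟨(r.2 - w.2 - 1).toNat, by omega⟩
  obtain ⟨dT, hdT⟩ : ∃ dT : ℕ, (dT : ℤ) = Y - r.2 - 1 := ⟨(Y - r.2 - 1).toNat, by omega⟩
  have htoNat : ∀ (a : ℤ) (k : ℕ), a = k → a.toNat = k := fun a k e => by subst e; exact Int.toNat_natCast k
  set x₁ : ℤ := w.1 + k₁ with hx₁def
  have hc₁x : x₁ < c₁ := by rcases hpassF.out with ⟨e1, e2, e3, -⟩ | ⟨e1, -, e3, -⟩ <;> omega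
  have hc₂ : c₂ = c₁ ∨ c₂ = x₁ := by rcases htopF.out with ⟨e, -⟩ | ⟨e, -⟩ <;> [exact Or.inl e; exact Or.inr e]
  have hc₂r : r.1 < c₂ := by rcases hc₂ with e | e <;> omega
  have hc₂F := Fact.mk hc₂
  clear hc₂
  obtain ⟨dC, hdC⟩ : ∃ dC : ℕ, (dC : ℤ) = c₁ - k₀ := ⟨(c₁ - k₀).toNat, by rcases hpassF.out with ⟨e1, e2, e3, -⟩ | ⟨e1, -, e3, -⟩ <;> omega⟩
  obtain ⟨dH, hdH⟩ : ∃ dH : ℕ, (dH : ℤ) = c₁ - x₁ - 1 := ⟨(c₁ - x₁ - 1).toNat, by omega⟩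
  obtain ⟨d₂, hd₂⟩ : ∃ d₂ : ℕ, (d₂ : ℤ) = c₂ - r.1 := ⟨(c₂ - r.1).toNat, by omega⟩
  obtain ⟨jB, hjB⟩ : ∃ jB : ℕ, ω.2.firstHitG + MW + (dL + 1) = jB := ⟨_, rfl⟩
  obtain ⟨jE, hjE⟩ : ∃ jE : ℕ, jB + (dR + 1) = jE := ⟨_, rfl⟩
  obtain ⟨i₀, hi₀⟩ : ∃ i₀ : ℕ, jE + (dB + 1) = i₀ := ⟨_, rfl⟩
  obtain ⟨iC, hiC⟩ : ∃ iC : ℕ, i₀ + dC = iC := ⟨_, rfl⟩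
  obtain ⟨i₁, hi₁⟩ : ∃ i₁ : ℕ, iC + (dM + 1) = i₁ := ⟨_, rfl⟩
  obtain ⟨jT, hjT⟩ : ∃ jT : ℕ, n - 1 - dT = jT := ⟨_, rfl⟩
  have eLF : Fact ((r.2 - Y').toNat = dL + 1) := ⟨htoNat _ _ (by push_cast; omega)⟩
  have eRF : Fact ((k₀ - (r.1 - MW)).toNat = dR + 1) := ⟨htoNat _ _ (by push_cast; omega)⟩
  have eBF : Fact ((w.2 - Y').toNat = dB + 1) := ⟨htoNat _ _ (by push_cast; omega)⟩
  have eCF : Fact ((c₁ - k₀).toNat = dC) := ⟨htoNat _ _ (by omega)⟩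
  have eMF : Fact ((r.2 - w.2).toNat = dM + 1) := ⟨htoNat _ _ (by push_cast; omega)⟩
  have eTF : Fact ((Y - r.2 - 1).toNat = dT) := ⟨htoNat _ _ (by omega)⟩
  have eT1F : Fact ((Y - r.2).toNat = dT + 1) := ⟨htoNat _ _ (by push_cast; omega)⟩
  have e₂F : Fact ((c₂ - r.1).toNat = d₂) := ⟨htoNat _ _ (by omega)⟩
  have eHF : Fact ((c₁ - (w.1 + (k₁ : ℤ))).toNat = dH + 1) := ⟨htoNat _ _ (by push_cast; omega)⟩
  have hIDX0F : Fact (ω.2.firstHitG + MW + (r.2 - Y').toNat + (k₀ - (r.1 - MW)).toNat + (w.2 - Y').toNat = i₀) :=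
    ⟨by rw [eLF.out, eRF.out, eBF.out]; omega⟩
  have hIDX1F : Fact (ω.2.firstHitG + MW + (r.2 - Y').toNat + (k₀ - (r.1 - MW)).toNat + (w.2 - Y').toNat + (c₁ - k₀).toNat +
      (r.2 - w.2).toNat = i₁) := ⟨by rw [eLF.out, eRF.out, eBF.out, eCF.out, eMF.out]; omega⟩
  have hTOPF : Fact (n - 1 - (Y - r.2 - 1).toNat = jT) := ⟨by rw [eTF.out]; exact hjT⟩
  rw [eLF.out] at hrunB
  rw [eLF.out, eRF.out] at hrunE
  have hi₀n := hi₀nF.out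
  rw [hIDX0F.out] at hi₀n
  rw [hIDX0F.out, eCF.out] at hclimb
  have hi₁n := hi₁nF.out
  rw [hIDX1F.out] at hi₁n
  have hMT := hMTF.out
  rw [hTOPF.out, e₂F.out] at hMT
  rw [hTOPF.out] at hTin hrunT hrunTin
  rw [hjB] at hrunB hrunE
  rw [hjE] at hrunE
  rw [show i₀ + dC = iC from hiC] at hclimb
  clear hi₀nF hi₁nF hMTF
  have hiC₀ : i₀ ≤ iC := by omega
  have hFi₀ : ω.2.firstHitG < i₀ := by omega
  have hjTn : jT < n := by omega
  have hNtop := forall_top_ne_N hh hr h hY (by omega)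
  have hfcT : ω.2.fc jT = (r.1, Y) := by have := hrunT 0 (by omega); rwa [Nat.sub_zero, Nat.cast_zero, add_zero] at this
  have hlow := prefix_row_ge_of_cost_seven_straight_holeColumn_above hh hr h hA hc hz hstr8 hcol habove hup
  have hhigh := prefix_row_le_of_cost_seven_straight_holeColumn_above hh hr h hA hc hz hstr8 hcol habove hup
  have hmemD : ∀ {c : Face} {s : Side}, ω.2.UsesSide c s → c ∈ D := by
    intro c s hu
    obtain ⟨j, hj, hfj⟩ := ω.2.exists_fc_eq_of_usesSide hu
    rw [← hfj]; exact (YBWalk.arcFace_arcAt hj).2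
  have ht₂col' : t₂.1 ≠ r.1 := by rw [ht₂]; simp only; omega
  ---------------------------------------------------------------- (P4) the prefix: `p₁` turns `N`, the column leads to the hook
  have hk₁ltF : k₁ < ω.2.firstHitG := by
    rcases Nat.lt_or_eq_of_le hk₁F with hlt | heq
    · exact hlt
    · exfalso; rw [heq, hfcF] at hfk; have := congrArg Prod.snd hfk; simp only at this; omega
  have hk₁N : ω.2.sOut k₁ = .N := by
    have hne := ω.2.sIn_ne_sOut (show k₁ < n by omega)
    rw [hWk] at hne
    have hkns := hk₁ns
    rw [hWk] at hkns
    have hnS : ω.2.sOut k₁ ≠ .S := by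
      intro hS
      have hk1n : k₁ + 1 < n := by omega
      have e := ω.2.fc_succ_eq_of_sOut_S hk1n hS
      rw [hfk] at e; simp only at e
      rcases Nat.lt_or_ge (k₁ + 1) ω.2.firstHitG with h1 | h1
      · have := hlow (k₁ + 1) h1
        rw [e] at this; simp only at this; omega
      · have : k₁ + 1 = ω.2.firstHitG := by omega
        rw [this, hfcF] at e
        have := congrArg Prod.snd e; simp only at this; omega
    revert hne hkns hnS; cases ω.2.sOut k₁ <;> decide
  -- up the column `x₁`
  have hcellsP : ∀ m : ℕ, 1 ≤ m → m ≤ dM → ∀ l < n, ω.2.fc l = ((ω.2.fc k₁).1, (ω.2.fc k₁).2 + m) → arcKind (ω.2.sIn l) (ω.2.sOut l) = .straight := by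
    intro m hm1 hmM l hl hfl
    rw [hfk] at hfl
    exact hvert l hl (by rw [hfl]; simp only; omega) (by rw [hfl]; simp only; omega) (by rw [hfl]; simp only; omega) (by rw [hfl]; simp only; omega)
  -- no plaquette of the column, nor the hook, is the first hit (wrong column); so the indices stay below `F`
  have hcolF : ∀ m : ℕ, m ≤ dM + 1 → k₁ + m ≠ ω.2.firstHitG := by
    intro m hm heq
    rcases Nat.eq_zero_or_pos m with h0 | hpos
    · omega
    have hrun := ω.2.run_up_of_straight (j := k₁) (M := m - 1) (by omega) hk₁N (fun m' hm1' hmM' l hl hfl => hcellsP m' hm1' (by omega) l hl hfl)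
    obtain ⟨e, hout⟩ := hrun (m - 1) le_rfl
    have hk1n : k₁ + (m - 1) + 1 < n := by omega
    have e2 := ω.2.fc_succ_eq_of_sOut_N hk1n hout
    rw [e, hfk] at e2; simp only at e2
    rw [show k₁ + (m - 1) + 1 = ω.2.firstHitG by omega, hfcF] at e2
    have := congrArg Prod.fst e2; simp only at this; omega
  have hkM : k₁ + dM + 1 < ω.2.firstHitG := by
    by_contra hge
    push Not at hge
    exact hcolF (ω.2.firstHitG - k₁) (by omega) (by omega)
  have hrunP := ω.2.run_up_of_straight (j := k₁) (M := dM) (by omega) hk₁N hcellsP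
  obtain ⟨hfcP, houtP⟩ := hrunP dM le_rfl
  rw [hfk] at hfcP
  have hfch := ω.2.fc_succ_eq_of_sOut_N (show k₁ + dM + 1 < n by omega) houtP
  have hinh := sIn_succ_eq_S ω.2 (show k₁ + dM + 1 < n by omega) houtP
  rw [hfcP] at hfch; simp only at hfch
  obtain ⟨jh, hjh⟩ : ∃ jh : ℕ, k₁ + dM + 1 = jh := ⟨_, rfl⟩
  rw [hjh] at hfch hinh hkM
  have hjhn : jh < n := by omega
  have hfch' : ω.2.fc jh = (x₁, r.2) := by rw [hfch]; exact Prod.ext rfl (by simp only; omega)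
  ---------------------------------------------------------------- plaquettes of the row of `r` using `S`; the climb cell; the hook does not use `E` without the hook kiss
  have hrow_r : ∀ x : ℤ, ω.2.UsesSide (x, r.2) .S → x = r.1 - MW ∨ x = x₁ ∨ x = c₁ := by
    intro x hu
    obtain ⟨M, hNall, -, hend⟩ := ω.2.chain_S hY' hu
    simp only at hNall hend
    rcases hend with ⟨hM1, hnot⟩ | ⟨-, hs0⟩ | ⟨hZ, -⟩
    · obtain ⟨i', hi', hfc', hsv', -, -, -, hk'⟩ := ω.2.isolated_of_usesSide_not_opp (hNall M hM1 le_rfl) hnot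
      have hP' : P (x, r.2 - M) := by rw [← hfc']; exact hPiso i' hi' hsv' hk'
      rcases hmem7 _ hP' with e | e | e | e | e | e | e
      · have := congrArg Prod.snd e; simp only at this; omega
      · have := congrArg Prod.snd e; rw [ht₂row] at this; simp only at this; omega
      · have := congrArg Prod.fst e; simp only at this; exact Or.inl this
      · have := congrArg Prod.fst e; simp only at this
        rcases hpassF.out with ⟨e1, -, e3, -⟩ | ⟨-, -, e3, -⟩
        · exact Or.inr (Or.inl (by omega))
        · exact Or.inr (Or.inr (by omega))
      · have := congrArg Prod.fst e; simp only at this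
        rcases hpassF.out with ⟨-, -, e3, -⟩ | ⟨-, e2, -, -⟩
        · exact Or.inr (Or.inr (by omega))
        · exact Or.inr (Or.inl (by omega))
      · have := congrArg Prod.snd e; simp only at this; omega
      · have := congrArg Prod.snd e; simp only at this; omega
    · exact absurd hs0 h0S
    · rw [hL] at hZ; have := congrArg Prod.snd hZ; simp only at this; omega
  -- the climb cell `(c₁, r.2) = fc i₁`, entered from `S`
  obtain ⟨hfcg, hing⟩ := hclimb (dM + 1) (by omega) (by omega)
  rw [show iC + (dM + 1) = i₁ by omega] at hfcg hing
  have hfcg' : ω.2.fc i₁ = (c₁, r.2) := by rw [hfcg]; exact Prod.ext rfl (by push_cast; omega)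
  -- without the hook kiss the climb cell is crossed straight and uses only `S` and `N`
  have hgnW : c₂ = c₁ → ¬ω.2.UsesSide (c₁, r.2) .W := by
    intro hcc hu
    rcases htopF.out with ⟨-, hgN, -, -⟩ | ⟨hcc', -⟩
    · rw [hIDX1F.out] at hgN
      obtain ⟨l, hl, hfl, hs⟩ := hu
      have el : l = i₁ := by
        by_contra hne
        exact (YBWalk.not_straight_of_two_arcs (γ := ω.2) (i := i₁) (i' := l) hi₁n hl (Ne.symm hne) (hfl.trans hfcg'.symm)).1
          (by rw [hing, hgN]; decide)
      subst el
      rw [hing, hgN] at hs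
      rcases hs with hs | hs <;> exact absurd hs (by decide)
    · omega
  have hhnE : c₂ = c₁ → ¬ω.2.UsesSide (x₁, r.2) .E := by
    intro hcc hhE
    -- the `E`-chain of `h` ends at `e_E`, strictly west of the climb column
    obtain ⟨M, hWall, -, hend⟩ := ω.2.chain_E hX' hhE
    simp only at hWall hend
    obtain ⟨hxE1, hxE2⟩ : x₁ < r.1 + ME ∧ r.1 + (ME : ℤ) < c₁ := by
      rcases hend with ⟨hM1, hnot⟩ | ⟨-, hs0⟩ | ⟨-, hsZ⟩
      · obtain ⟨i', hi', hfc', hsv', -, -, -, hk'⟩ := ω.2.isolated_of_usesSide_not_opp (hWall M hM1 le_rfl) hnot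
        have hP' : P (x₁ + M, r.2) := by rw [← hfc']; exact hPiso i' hi' hsv' hk'
        have hxM : x₁ + (M : ℤ) = r.1 + ME := by
          rcases hmem7 _ hP' with e | e | e | e | e | e | e
          · have := congrArg Prod.snd e; simp only at this; omega
          · have := congrArg Prod.snd e; rw [ht₂row] at this; simp only at this; omega
          · have := congrArg Prod.snd e; simp only at this; omega
          · have := congrArg Prod.snd e; simp only at this; omega
          · have := congrArg Prod.snd e; simp only at this; omega
          · have := congrArg Prod.fst e; simp only at this; omega
          · have := congrArg Prod.fst e; simp only at this; exact this
        refine ⟨by omega, ?_⟩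
        by_contra hge
        push Not at hge
        obtain ⟨mm, hmm⟩ : ∃ mm : ℕ, (mm : ℤ) = c₁ - x₁ := ⟨(c₁ - x₁).toNat, by omega⟩
        have hgW := hWall mm (by omega) (by omega)
        rw [show ((x₁ + (mm : ℤ), r.2) : Face) = (c₁, r.2) from Prod.ext (by simp only; omega) rfl] at hgW
        exact hgnW hcc hgW
      · exact absurd hs0 h0E
      · rw [hLS] at hsZ; exact absurd hsZ (by decide)
    -- `e_E` then turns `N` (its column carries no `S`-user): a third top turn
    obtain ⟨jEE, hjEE, hfcEE, hsW⟩ := hWE ME hME1 le_rfl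
    have hne2 := ω.2.sIn_ne_sOut hjEE
    have hnE1 : ω.2.sIn jEE ≠ .E := fun e => hnotE ⟨jEE, hjEE, hfcEE, Or.inl e⟩
    have hnE2 : ω.2.sOut jEE ≠ .E := fun e => hnotE ⟨jEE, hjEE, hfcEE, Or.inr e⟩
    have hnS1 : ω.2.sIn jEE ≠ .S := by
      intro e; rcases hrow_r _ ⟨jEE, hjEE, hfcEE, Or.inl e⟩ with e' | e' | e' <;> omega
    have hnS2 : ω.2.sOut jEE ≠ .S := by
      intro e; rcases hrow_r _ ⟨jEE, hjEE, hfcEE, Or.inr e⟩ with e' | e' | e' <;> omega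
    have heEN : ω.2.UsesSide ((r.1 : ℤ) + ME, r.2) .N := by
      refine ⟨jEE, hjEE, hfcEE, ?_⟩
      revert hsW hne2 hnE1 hnE2 hnS1 hnS2; cases ω.2.sIn jEE <;> cases ω.2.sOut jEE <;> decide
    obtain ⟨M', hS', -, hend'⟩ := ω.2.chain_N hY heEN
    simp only at hS' hend'
    rcases hend' with ⟨hM1, hnot⟩ | ⟨-, hs0⟩ | ⟨hZ, -⟩
    · obtain ⟨i', hi', hfc', hsv', -, -, -, hk'⟩ := ω.2.isolated_of_usesSide_not_opp (hS' M' hM1 le_rfl) hnot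
      have hP' : P ((r.1 : ℤ) + ME, r.2 + M') := by rw [← hfc']; exact hPiso i' hi' hsv' hk'
      have hrow' : ((((r.1 : ℤ) + ME, r.2 + M') : Face)).2 = Y := by
        rcases hProw _ hP' with e | e | e | e <;> simp only at e ⊢ <;> omega
      rcases htops _ hP' hrow' with e | e
      · have := congrArg Prod.fst e; simp only at this; omega
      · rw [ht₂, hcc] at e; have := congrArg Prod.fst e; simp only at this; omega
    · exact absurd hs0 h0N
    · rw [hL] at hZ; have := congrArg Prod.fst hZ; simp only at this; omega
  -- with the hook kiss, the arrival arc at `h` is `E → N`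
  have hharr : c₂ = x₁ → i₁ + (dH + 1) < n ∧ ω.2.fc (i₁ + (dH + 1)) = (x₁, r.2) ∧ ω.2.sIn (i₁ + (dH + 1)) = .E ∧
      ω.2.sOut (i₁ + (dH + 1)) = .N := by
    intro hcc
    rcases htopF.out with ⟨hcc', -⟩ | ⟨-, -, -, hrunH, houtH, -, hidx⟩
    · omega
    · rw [hIDX1F.out] at hrunH
      rw [hIDX1F.out, eHF.out] at houtH
      rw [hIDX1F.out, eHF.out, eT1F.out, hTOPF.out, e₂F.out] at hidx
      obtain ⟨eh, einh⟩ := hrunH (dH + 1) (by omega) (by push_cast; omega)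
      have hlt : i₁ + (dH + 1) < n := by
        have := hidx; clear hidx
        omega
      exact ⟨hlt, by rw [eh]; exact Prod.ext (by push_cast; omega) rfl, einh, houtH⟩
  ---------------------------------------------------------------- the hook is left through `W`; the row of `r` leads into `r`
  have houth : ω.2.sOut jh = .W := by
    have hne := ω.2.sIn_ne_sOut hjhn
    rw [hinh] at hne
    have hnN : ω.2.sOut jh ≠ .N := by
      intro hN
      have e := ω.2.fc_succ_eq_of_sOut_N (show jh + 1 < n by omega) hN
      rw [hfch'] at e; simp only at e
      rcases Nat.lt_or_ge (jh + 1) ω.2.firstHitG with h1 | h1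
      · have := hhigh (jh + 1) h1
        rw [e] at this; simp only at this; omega
      · have : jh + 1 = ω.2.firstHitG := by omega
        rw [this, hfcF] at e
        have := congrArg Prod.snd e; simp only at this; omega
    have hnE : ω.2.sOut jh ≠ .E := by
      intro hE
      rcases hc₂F.out with hcc | hcc
      · exact hhnE hcc ⟨jh, hjhn, hfch', Or.inr hE⟩
      · obtain ⟨hiH, eh', einh, -⟩ := hharr hcc
        have hne' : jh ≠ i₁ + (dH + 1) := by omega
        obtain ⟨-, -, h3, -, -⟩ := YBWalk.not_straight_of_two_arcs (γ := ω.2) (i := jh) (i' := i₁ + (dH + 1)) hjhn hiH hne' (eh'.trans hfch'.symm)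
        rw [einh, hE] at h3; exact h3 rfl
    revert hne hnN hnE; cases ω.2.sOut jh <;> decide
  -- west along the row of `r`: each step stays on the row (no way up, no way down), until `r`
  have hrowRun : ∀ m : ℕ, m ≤ k₁ → ω.2.fc (jh + m) = (x₁ - m, r.2) ∧ ω.2.sOut (jh + m) = .W ∧ jh + m < ω.2.firstHitG := by
    intro m
    induction m with
    | zero => intro _; exact ⟨by rw [Nat.add_zero, hfch']; exact Prod.ext (by simp only; omega) rfl, houth, by omega⟩
    | succ m ih =>
      intro hm
      obtain ⟨hfcm, houtm, hltm⟩ := ih (by omega)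
      have hm1n : jh + m + 1 < n := by omega
      obtain ⟨efc, ein⟩ := ω.2.fc_succ_eq_of_sOut_W hm1n houtm
      rw [hfcm] at efc; simp only at efc
      have efc' : ω.2.fc (jh + (m + 1)) = (x₁ - ((m + 1 : ℕ) : ℤ), r.2) := by
        rw [show jh + (m + 1) = jh + m + 1 by omega, efc]; exact Prod.ext (by simp only; push_cast; ring) rfl
      rw [show jh + m + 1 = jh + (m + 1) by omega] at ein hm1n
      -- the new index is below `F` (its plaquette is not `r`)
      have hltF : jh + (m + 1) < ω.2.firstHitG := by
        rcases Nat.lt_or_ge (jh + (m + 1)) ω.2.firstHitG with h1 | h1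
        · exact h1
        · exfalso
          have : jh + (m + 1) = ω.2.firstHitG := by omega
          rw [this, hfcF] at efc'
          have := congrArg Prod.fst efc'; simp only at this; omega
      refine ⟨efc', ?_, hltF⟩
      have hne := ω.2.sIn_ne_sOut hm1n
      rw [ein] at hne
      have hnN : ω.2.sOut (jh + (m + 1)) ≠ .N := by
        intro hN
        have hm2n : jh + (m + 1) + 1 < n := by omega
        have e := ω.2.fc_succ_eq_of_sOut_N hm2n hN
        rw [efc'] at e; simp only at e
        rcases Nat.lt_or_ge (jh + (m + 1) + 1) ω.2.firstHitG with h1 | h1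
        · have := hhigh _ h1
          rw [e] at this; simp only at this; omega
        · have : jh + (m + 1) + 1 = ω.2.firstHitG := by omega
          rw [this, hfcF] at e
          have := congrArg Prod.snd e; simp only at this; omega
      have hnS : ω.2.sOut (jh + (m + 1)) ≠ .S := by
        intro hS
        -- the plaquette below, `(x₁ − (m+1), r.2 − 1)`, at a prefix index
        have hm2n : jh + (m + 1) + 1 < n := by omega
        have e := ω.2.fc_succ_eq_of_sOut_S hm2n hS
        have ein2 := sIn_succ_eq_N ω.2 hm2n hS
        rw [efc'] at e; simp only at e
        have h1 : jh + (m + 1) + 1 < ω.2.firstHitG := by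
          rcases Nat.lt_or_ge (jh + (m + 1) + 1) ω.2.firstHitG with h1 | h1
          · exact h1
          · exfalso
            have : jh + (m + 1) + 1 = ω.2.firstHitG := by omega
            rw [this, hfcF] at e
            have := congrArg Prod.snd e; simp only at this; omega
        by_cases hrow1 : r.2 - 1 = w.2
        · -- the plaquette below lies on the straight prefix run
          obtain ⟨hrun0, -⟩ := ω.2.initial_run hh (show k₁ < n by omega) hstr
          obtain ⟨m₀, hm₀⟩ : ∃ m₀ : ℕ, (m₀ : ℤ) = x₁ - ((m + 1 : ℕ) : ℤ) - w.1 := ⟨(x₁ - ((m + 1 : ℕ) : ℤ) - w.1).toNat, by push_cast; omega⟩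
          have hm₀k : m₀ < k₁ := by push_cast at hm₀; omega
          have e0 := (hrun0 m₀ (by omega)).1
          have hsame : ω.2.fc m₀ = ω.2.fc (jh + (m + 1) + 1) := by
            rw [e0, e]; exact Prod.ext (by simp only; omega) (by simp only; omega)
          -- a straight cell is singly visited
          have := YBWalk.not_straight_of_two_arcs (γ := ω.2) (i := m₀) (i' := jh + (m + 1) + 1) (by omega) hm2n (by omega) hsame.symm
          exact this.1 (ω.2.sOut_of_straight (by omega) (hstr m₀ hm₀k))
        · -- strictly between the rows: a vertical cell using `S`, in a column without bottom turn
          have hjn' := hm2n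
          have hk := hvert _ hjn' (by rw [e]; simp only; omega) (by rw [e]; simp only; omega) (by rw [e]; simp only; omega)
            (by rw [e]; simp only; omega)
          have hcS : ω.2.UsesSide (x₁ - ((m + 1 : ℕ) : ℤ), r.2 - 1) .S := by
            refine ⟨_, hjn', e, ?_⟩
            have key : ∀ s t : Side, arcKind s t = .straight → s = .N → t = .S := by decide
            exact Or.inr (key _ _ hk ein2)
          obtain ⟨M, hNall, -, hend⟩ := ω.2.chain_S hY' hcS
          simp only at hNall hend
          rcases hend with ⟨hM1, hnot⟩ | ⟨-, hs0⟩ | ⟨hZ, -⟩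
          · obtain ⟨i', hi', hfc', hsv', -, -, -, hk'⟩ := ω.2.isolated_of_usesSide_not_opp (hNall M hM1 le_rfl) hnot
            have hP' : P (x₁ - ((m + 1 : ℕ) : ℤ), r.2 - 1 - M) := by rw [← hfc']; exact hPiso i' hi' hsv' hk'
            rcases hmem7 _ hP' with e' | e' | e' | e' | e' | e' | e'
            · have := congrArg Prod.snd e'; simp only at this; omega
            · have := congrArg Prod.snd e'; rw [ht₂row] at this; simp only at this; omega
            · have := congrArg Prod.fst e'; simp only at this; omega
            · have := congrArg Prod.fst e'; simp only at this; omega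
            · have := congrArg Prod.fst e'; simp only at this
              rcases hpassF.out with ⟨e1, e2, -⟩ | ⟨-, e2, -⟩ <;> omega
            · have := congrArg Prod.snd e'; simp only at this; omega
            · have := congrArg Prod.snd e'; simp only at this; omega
          · exact absurd hs0 h0S
          · rw [hL] at hZ; have := congrArg Prod.snd hZ; simp only at this; omega
      revert hne hnN hnS; cases ω.2.sOut (jh + (m + 1)) <;> decide
  obtain ⟨hfcK, houtK, -⟩ := hrowRun k₁ le_rfl
  have hKn : jh + k₁ + 1 < n := by omega
  obtain ⟨hfcr, -⟩ := ω.2.fc_succ_eq_of_sOut_W hKn houtK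
  rw [hfcK] at hfcr; simp only at hfcr
  have hfcr' : ω.2.fc (jh + k₁ + 1) = r := by rw [hfcr]; exact Prod.ext (by simp only; omega) rfl
  have hFeq : jh + k₁ + 1 = ω.2.firstHitG := hsvr _ hKn (hfcr'.trans hfcF.symm)
  ---------------------------------------------------------------- `e_E = h` without the hook kiss
  have hME : c₂ = c₁ → (ME : ℤ) = k₁ + 1 := by
    intro hcc
    obtain ⟨jEE, hjEE, hfcEE, hsW⟩ := hWE ME hME1 le_rfl
    have hne2 := ω.2.sIn_ne_sOut hjEE
    have hnE1 : ω.2.sIn jEE ≠ .E := fun e => hnotE ⟨jEE, hjEE, hfcEE, Or.inl e⟩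
    have hnE2 : ω.2.sOut jEE ≠ .E := fun e => hnotE ⟨jEE, hjEE, hfcEE, Or.inr e⟩
    by_contra hne
    -- `e_E ≠ h`; its vertical side is `N` or `S`
    by_cases hS : ω.2.UsesSide ((r.1 : ℤ) + ME, r.2) .S
    · rcases hrow_r _ hS with e | e | e
      · omega
      · omega
      · -- `e_E` would be the climb cell, which does not use `W`
        have hgW := hWE ME hME1 le_rfl
        rw [show (((r.1 : ℤ) + ME, r.2) : Face) = (c₁, r.2) from Prod.ext (by simp only; omega) rfl] at hgW
        exact hgnW hcc hgW
    · have hnS1 : ω.2.sIn jEE ≠ .S := fun e => hS ⟨jEE, hjEE, hfcEE, Or.inl e⟩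
      have hnS2 : ω.2.sOut jEE ≠ .S := fun e => hS ⟨jEE, hjEE, hfcEE, Or.inr e⟩
      have heEN : ω.2.UsesSide ((r.1 : ℤ) + ME, r.2) .N := by
        refine ⟨jEE, hjEE, hfcEE, ?_⟩
        revert hsW hne2 hnE1 hnE2 hnS1 hnS2; cases ω.2.sIn jEE <;> cases ω.2.sOut jEE <;> decide
      obtain ⟨M', hS', -, hend'⟩ := ω.2.chain_N hY heEN
      simp only at hS' hend'
      rcases hend' with ⟨hM1, hnot⟩ | ⟨-, hs0⟩ | ⟨hZ, -⟩
      · obtain ⟨i', hi', hfc', hsv', -, -, -, hk'⟩ := ω.2.isolated_of_usesSide_not_opp (hS' M' hM1 le_rfl) hnot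
        have hP' : P ((r.1 : ℤ) + ME, r.2 + M') := by rw [← hfc']; exact hPiso i' hi' hsv' hk'
        have hrow' : ((((r.1 : ℤ) + ME, r.2 + M') : Face)).2 = Y := by
          rcases hProw _ hP' with e | e | e | e <;> simp only at e ⊢ <;> omega
        rcases htops _ hP' hrow' with e | e
        · have := congrArg Prod.fst e; simp only at this; omega
        · rw [ht₂, hcc] at e; have ex := congrArg Prod.fst e; simp only at ex
          -- `e_E = (c₁, r.2)` uses `W`: excluded
          have hgW := hWE ME hME1 le_rfl
          rw [show (((r.1 : ℤ) + ME, r.2) : Face) = (c₁, r.2) from Prod.ext (by simp only; omega) rfl] at hgW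
          exact hgnW hcc hgW
      · exact absurd hs0 h0N
      · rw [hL] at hZ; have := congrArg Prod.fst hZ; simp only at this; omega
  ---------------------------------------------------------------- assemble
  have hpass := hpassF.out
  have htop := htopF.out
  have hIDX0 := hIDX0F.out
  have hIDX1 := hIDX1F.out
  have hTOP := hTOPF.out
  have eM : (r.2 - w.2).toNat = dM + 1 := htoNat _ _ (by push_cast; omega)
  have eL : (r.2 - Y').toNat = dL + 1 := htoNat _ _ (by push_cast; omega)
  have eR : (k₀ - (r.1 - MW)).toNat = dR + 1 := htoNat _ _ (by push_cast; omega)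
  have eC : (c₁ - k₀).toNat = dC := htoNat _ _ (by omega)
  have e₂ : (c₂ - r.1).toNat = d₂ := htoNat _ _ (by omega)
  refine ⟨c₂, c₁, Y, Y', τ1, k₀, MW, ME, k₁, t₂, hY, hY', hr₃, hY'w, ht₂row, ht₂col', hτ1w, hMW1, hME1, hEW, hWW, hnotW, hWE, hEE, hnotE, hseven, hall,
    hN1, hL, hLS, hdesc, hdescIn, heWS, heWnN, hlegN, hlegS, hbWnS, hk₁F, hstr, hk₁ns, hfk, hWk, hk₀w, hbotS, hbWnW, hbEnE, hbEnS, hinF, houtF,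
    hrunR, hrunL, ?_, ?_, ?_, hpass, ?_, ?_, ht₂, ?_, ?_, ?_, ?_, htop, hk₁N, ?_, ?_, ?_, ?_, hME, hhnE, hgnW⟩
  · rw [eL, hjB]; exact hrunB
  · rw [eL, eR, hjB, hjE]; exact hrunE
  · rw [hIDX0]; exact hi₀n
  · rw [hIDX0, eC, hiC]; exact hclimb
  · rw [hIDX1]; exact hi₁n
  · rw [hTOP]; exact hTin
  · rw [hTOP, e₂]; exact hMT
  · rw [hTOP]; exact hrunT
  · rw [hTOP]; exact hrunTin
  · intro m hm1 hmM
    clear eM eL eR eC e₂ hIDX0 hIDX1 hTOP hpass htop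
    rcases Nat.lt_or_ge dM m with hbig | hsmall
    · have em : m = dM + 1 := by omega
      subst em
      rw [show k₁ + (dM + 1) = jh from hjh]
      exact ⟨by rw [hfch']; exact Prod.ext rfl (by push_cast; omega), hinh⟩
    · rcases Nat.eq_zero_or_pos m with h0 | hpos
      · omega
      obtain ⟨e1, e1o⟩ := hrunP (m - 1) (by omega)
      have hjm : k₁ + (m - 1) + 1 < n := by omega
      have e2 := ω.2.fc_succ_eq_of_sOut_N hjm e1o
      have e3 := sIn_succ_eq_S ω.2 hjm e1o
      rw [e1, hfk] at e2; simp only at e2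
      rw [show k₁ + (m - 1) + 1 = k₁ + m by omega] at e2 e3
      exact ⟨by rw [e2]; exact Prod.ext rfl (by push_cast [Nat.cast_sub hpos]; ring), e3⟩
  · rw [eM, show k₁ + (dM + 1) = jh from hjh]; exact houth
  · intro m hm1 hmM
    rw [eM, show k₁ + (dM + 1) = jh from hjh]
    clear eM eL eR eC e₂ hIDX0 hIDX1 hTOP hpass htop
    rcases Nat.lt_or_ge k₁ m with hbig | hsmall
    · have em : m = k₁ + 1 := by omega
      subst em
      obtain ⟨-, hin⟩ := ω.2.fc_succ_eq_of_sOut_W hKn houtK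
      rw [show jh + (k₁ + 1) = jh + k₁ + 1 from rfl]
      exact ⟨by rw [hfcr']; exact Prod.ext (by push_cast; omega) rfl, hin⟩
    · obtain ⟨e1, -, -⟩ := hrowRun m hsmall
      rcases Nat.eq_zero_or_pos m with h0 | hpos
      · omega
      obtain ⟨-, houtp, -⟩ := hrowRun (m - 1) (by omega)
      have hjm : jh + (m - 1) + 1 < n := by omega
      obtain ⟨-, hin⟩ := ω.2.fc_succ_eq_of_sOut_W hjm houtp
      rw [show jh + (m - 1) + 1 = jh + m by omega] at hin
      exact ⟨e1, hin⟩
  · rw [eM, show k₁ + (dM + 1) = jh from hjh]; clear eM eL eR eC e₂ hIDX0 hIDX1 hTOP hpass htop; omega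

/-- ★★★ **HOLE COLUMN: THE HOOK.** Let `ω` be a wound class-`B2a` walk of limit cost `7` from the hole root `w.side W` (hole `(w.1 − 1, w.2)` absent) with a slanted end and a
STRAIGHT first arc at a rhombus `r` of the hole column (`r.1 = w.1 − 1`) strictly above the hole, some arc of `ω` lying strictly above the row of `r`. Then, with the data of
`topClimb_of_cost_seven_straight_holeColumn_above` (whole excursion pinned; `x₁ = w.1 + k₁`, `p₁ = (x₁, w.2)` the first turning plaquette, `k₀` the east-leg column, `c₁` the
climb column, `c₂` the column of the second top turn): `p₁` is left through `N`; the plaquettes `(x₁, w.2 + m)`, `1 ≤ m ≤ r.2 − w.2`, follow entered from `S`, the last — the hook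
plaquette `h = (x₁, r.2)` — is left through `W`; the plaquettes `(x₁ − m, r.2)`, `1 ≤ m ≤ k₁ + 1`, follow entered from `E`, the last being `r` at `F = k₁ + (r.2 − w.2) + k₁ + 1`;
without the hook kiss (`c₂ = c₁`) `ME = k₁ + 1`; a plaquette visited at two different indices is `p₁` with `k₀ = x₁` or `h` with `c₂ = x₁`; and the indices at `p₁` are `k₁` and
(if `k₀ = x₁`) the loop's arrival `i₀`, those at `h` are `k₁ + (r.2 − w.2)` and (if `c₂ = x₁`) the arrival `i₁ + (c₁ − x₁)` from `e_E`.
[cite: GlazmanManolescu2019, §1, Fig. 1 and eq. (1); Lemma 2.1; Remark 2.2] [cite: Glazman2015WeightedSAW, Lemma 3.1 (proof, pp. 6–7)] [cite: CourantRobbins1958, Ch. V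
Appendix §2 (the even–odd rule)] -/
theorem hook_of_cost_seven_straight_holeColumn_above (hh : holeFaceW w ∉ D) (hr : RootedFace D (w.side .W) r) (h : ω.IsB2a)
    (hA : ω.AJ hr h (toC (midPt (w.side .W))) ≠ 0) (hc : cost (slotOfSide ω.1) ω.2.mids = 7) (hz : ω.1 = .N ∨ ω.1 = .S)
    (hstr8 : arcKind (ω.2.sIn ω.2.firstHitG) (ω.2.sOut ω.2.firstHitG) = .straight) (hcol : r.1 = w.1 - 1) (habove : w.2 < r.2)
    (hup : ∃ j < ω.2.arcs.length, r.2 < (ω.2.fc j).2) :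
    ∃ (c₂ : ℤ), ∃ (c₁ : ℤ), ∃ (Y Y' τ1 k₀ : ℤ) (MW ME k₁ : ℕ) (t₂ : Face),
      (∀ j < ω.2.arcs.length, (ω.2.fc j).2 ≤ Y) ∧ (∀ j < ω.2.arcs.length, Y' ≤ (ω.2.fc j).2) ∧ r.2 < Y ∧ Y' < w.2 ∧
      t₂.2 = Y ∧ t₂.1 ≠ r.1 ∧ w.1 ≤ τ1 ∧ 1 ≤ MW ∧ 1 ≤ ME ∧
      (∀ m : ℕ, 1 ≤ m → m ≤ MW → ω.2.UsesSide (r.1 - m, r.2) .E) ∧ (∀ m : ℕ, m < MW → ω.2.UsesSide (r.1 - m, r.2) .W) ∧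
        ¬ω.2.UsesSide (r.1 - MW, r.2) .W ∧
      (∀ m : ℕ, 1 ≤ m → m ≤ ME → ω.2.UsesSide (r.1 + m, r.2) .W) ∧ (∀ m : ℕ, m < ME → ω.2.UsesSide (r.1 + m, r.2) .E) ∧
        ¬ω.2.UsesSide (r.1 + ME, r.2) .E ∧
      (∀ f ∈ ({((r.1 : ℤ), Y), t₂, ((r.1 : ℤ) - MW, Y'), (k₀, Y'), ((τ1 : ℤ), w.2), ((r.1 : ℤ) - MW, r.2), ((r.1 : ℤ) + ME, r.2)} : Finset Face),
        f ∈ facesL ω.2.mids ∧ (kindsL ω.2.mids f = [.corner] ∨ kindsL ω.2.mids f = [.coCorner])) ∧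
      (∀ f : Face, f ∈ facesL ω.2.mids → (kindsL ω.2.mids f = [.corner] ∨ kindsL ω.2.mids f = [.coCorner]) →
        f ∈ ({((r.1 : ℤ), Y), t₂, ((r.1 : ℤ) - MW, Y'), (k₀, Y'), ((τ1 : ℤ), w.2), ((r.1 : ℤ) - MW, r.2), ((r.1 : ℤ) + ME, r.2)} : Finset Face)) ∧
      ω.1 = .N ∧ ω.2.fc (ω.2.arcs.length - 1) = (r.1, r.2 + 1) ∧ ω.2.sOut (ω.2.arcs.length - 1) = .S ∧
      (∀ m : ℕ, (m : ℤ) ≤ Y - r.2 - 1 → ω.2.fc (ω.2.arcs.length - 1 - m) = (r.1, r.2 + 1 + m)) ∧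
      (∀ m : ℕ, (m : ℤ) < Y - r.2 - 1 → ω.2.sIn (ω.2.arcs.length - 1 - m) = .N) ∧
      ω.2.UsesSide (r.1 - MW, r.2) .S ∧ ¬ω.2.UsesSide (r.1 - MW, r.2) .N ∧
      (∀ m : ℕ, 1 ≤ m → (m : ℤ) ≤ r.2 - Y' → ω.2.UsesSide (r.1 - MW, r.2 - m) .N) ∧
      (∀ m : ℕ, (m : ℤ) < r.2 - Y' → ω.2.UsesSide (r.1 - MW, r.2 - m) .S) ∧ ¬ω.2.UsesSide (r.1 - MW, Y') .S ∧
      -- new in this car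
      k₁ ≤ ω.2.firstHitG ∧ (∀ j < k₁, arcKind (ω.2.sIn j) (ω.2.sOut j) = .straight) ∧ arcKind (ω.2.sIn k₁) (ω.2.sOut k₁) ≠ .straight ∧
      ω.2.fc k₁ = (w.1 + k₁, w.2) ∧ ω.2.sIn k₁ = .W ∧ w.1 + k₁ ≤ k₀ ∧
      (∀ x : ℤ, ¬ω.2.UsesSide (x, Y') .S) ∧ ¬ω.2.UsesSide (r.1 - MW, Y') .W ∧ ¬ω.2.UsesSide (k₀, Y') .E ∧ ¬ω.2.UsesSide (k₀, Y') .S ∧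
      ω.2.sIn ω.2.firstHitG = .E ∧ ω.2.sOut ω.2.firstHitG = .W ∧
      (∀ m : ℕ, m ≤ MW → ω.2.fc (ω.2.firstHitG + m) = (r.1 - m, r.2) ∧ ω.2.sIn (ω.2.firstHitG + m) = .E) ∧
      (∀ m : ℕ, 1 ≤ m → (m : ℤ) ≤ r.2 - Y' → ω.2.fc (ω.2.firstHitG + MW + m) = (r.1 - MW, r.2 - m) ∧ ω.2.sIn (ω.2.firstHitG + MW + m) = .N) ∧
      (∀ m : ℕ, 1 ≤ m → (m : ℤ) ≤ k₀ - (r.1 - MW) →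
        ω.2.fc (ω.2.firstHitG + MW + (r.2 - Y').toNat + m) = (r.1 - MW + m, Y') ∧ ω.2.sIn (ω.2.firstHitG + MW + (r.2 - Y').toNat + m) = .W) ∧
      (∀ m : ℕ, 1 ≤ m → (m : ℤ) ≤ w.2 - Y' →
        ω.2.fc (ω.2.firstHitG + MW + (r.2 - Y').toNat + (k₀ - (r.1 - MW)).toNat + m) = (k₀, Y' + m) ∧
          ω.2.sIn (ω.2.firstHitG + MW + (r.2 - Y').toNat + (k₀ - (r.1 - MW)).toNat + m) = .S) ∧
      ω.2.firstHitG + MW + (r.2 - Y').toNat + (k₀ - (r.1 - MW)).toNat + (w.2 - Y').toNat < ω.2.arcs.length ∧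
      -- new in this car: the root-row passage and the climb to the row of `r`
      ((k₀ = w.1 + k₁ ∧ w.1 + k₁ < τ1 ∧ c₁ = τ1 ∧ ω.2.sOut k₁ = .N ∧
          ω.2.sOut (ω.2.firstHitG + MW + (r.2 - Y').toNat + (k₀ - (r.1 - MW)).toNat + (w.2 - Y').toNat) = .E ∧
          (∀ m : ℕ, 1 ≤ m → (m : ℤ) ≤ τ1 - (w.1 + k₁) →
            ω.2.fc (ω.2.firstHitG + MW + (r.2 - Y').toNat + (k₀ - (r.1 - MW)).toNat + (w.2 - Y').toNat + m) = (w.1 + k₁ + m, w.2) ∧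
            ω.2.sIn (ω.2.firstHitG + MW + (r.2 - Y').toNat + (k₀ - (r.1 - MW)).toNat + (w.2 - Y').toNat + m) = .W) ∧
          ω.2.sOut (ω.2.firstHitG + MW + (r.2 - Y').toNat + (k₀ - (r.1 - MW)).toNat + (w.2 - Y').toNat + (τ1 - (w.1 + k₁)).toNat) = .N) ∨
        (w.1 + k₁ < k₀ ∧ τ1 = w.1 + k₁ ∧ c₁ = k₀ ∧ ¬ω.2.UsesSide (w.1 + k₁, w.2) .S ∧ ¬ω.2.UsesSide (w.1 + k₁, w.2) .E ∧ ¬ω.2.UsesSide (k₀, w.2) .W ∧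
          ω.2.sOut (ω.2.firstHitG + MW + (r.2 - Y').toNat + (k₀ - (r.1 - MW)).toNat + (w.2 - Y').toNat) = .N)) ∧
      (∀ m : ℕ, 1 ≤ m → (m : ℤ) ≤ r.2 - w.2 →
        ω.2.fc (ω.2.firstHitG + MW + (r.2 - Y').toNat + (k₀ - (r.1 - MW)).toNat + (w.2 - Y').toNat + (c₁ - k₀).toNat + m) = (c₁, w.2 + m) ∧
          ω.2.sIn (ω.2.firstHitG + MW + (r.2 - Y').toNat + (k₀ - (r.1 - MW)).toNat + (w.2 - Y').toNat + (c₁ - k₀).toNat + m) = .S) ∧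
      ω.2.firstHitG + MW + (r.2 - Y').toNat + (k₀ - (r.1 - MW)).toNat + (w.2 - Y').toNat + (c₁ - k₀).toNat + (r.2 - w.2).toNat < ω.2.arcs.length ∧
      -- new in this car: the climb to the top row and the top row into `T`
      t₂ = (c₂, Y) ∧ ω.2.sIn (ω.2.arcs.length - 1 - (Y - r.2 - 1).toNat) = .E ∧ (c₂ - r.1).toNat ≤ ω.2.arcs.length - 1 - (Y - r.2 - 1).toNat ∧
      (∀ m : ℕ, (m : ℤ) ≤ c₂ - r.1 → ω.2.fc (ω.2.arcs.length - 1 - (Y - r.2 - 1).toNat - m) = (r.1 + m, Y)) ∧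
      (∀ m : ℕ, (m : ℤ) < c₂ - r.1 → ω.2.sIn (ω.2.arcs.length - 1 - (Y - r.2 - 1).toNat - m) = .E) ∧
      ((c₂ = c₁ ∧ ω.2.sOut (ω.2.firstHitG + MW + (r.2 - Y').toNat + (k₀ - (r.1 - MW)).toNat + (w.2 - Y').toNat + (c₁ - k₀).toNat + (r.2 - w.2).toNat) = .N ∧
          (∀ m : ℕ, 1 ≤ m → (m : ℤ) ≤ Y - r.2 → ω.2.fc (ω.2.firstHitG + MW + (r.2 - Y').toNat + (k₀ - (r.1 - MW)).toNat + (w.2 - Y').toNat + (c₁ - k₀).toNat + (r.2 - w.2).toNat + m) = (c₁, r.2 + m) ∧ ω.2.sIn (ω.2.firstHitG + MW + (r.2 - Y').toNat + (k₀ - (r.1 - MW)).toNat + (w.2 - Y').toNat + (c₁ - k₀).toNat + (r.2 - w.2).toNat + m) = .S) ∧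
          ω.2.firstHitG + MW + (r.2 - Y').toNat + (k₀ - (r.1 - MW)).toNat + (w.2 - Y').toNat + (c₁ - k₀).toNat + (r.2 - w.2).toNat + (Y - r.2).toNat = ω.2.arcs.length - 1 - (Y - r.2 - 1).toNat - (c₂ - r.1).toNat) ∨
        (c₂ = w.1 + k₁ ∧ (ME : ℤ) = c₁ - r.1 ∧ ω.2.sOut (ω.2.firstHitG + MW + (r.2 - Y').toNat + (k₀ - (r.1 - MW)).toNat + (w.2 - Y').toNat + (c₁ - k₀).toNat + (r.2 - w.2).toNat) = .W ∧
          (∀ m : ℕ, 1 ≤ m → (m : ℤ) ≤ c₁ - (w.1 + k₁) → ω.2.fc (ω.2.firstHitG + MW + (r.2 - Y').toNat + (k₀ - (r.1 - MW)).toNat + (w.2 - Y').toNat + (c₁ - k₀).toNat + (r.2 - w.2).toNat + m) = (c₁ - m, r.2) ∧ ω.2.sIn (ω.2.firstHitG + MW + (r.2 - Y').toNat + (k₀ - (r.1 - MW)).toNat + (w.2 - Y').toNat + (c₁ - k₀).toNat + (r.2 - w.2).toNat + m) = .E) ∧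
          ω.2.sOut (ω.2.firstHitG + MW + (r.2 - Y').toNat + (k₀ - (r.1 - MW)).toNat + (w.2 - Y').toNat + (c₁ - k₀).toNat + (r.2 - w.2).toNat + (c₁ - (w.1 + k₁)).toNat) = .N ∧
          (∀ m : ℕ, 1 ≤ m → (m : ℤ) ≤ Y - r.2 →
            ω.2.fc (ω.2.firstHitG + MW + (r.2 - Y').toNat + (k₀ - (r.1 - MW)).toNat + (w.2 - Y').toNat + (c₁ - k₀).toNat + (r.2 - w.2).toNat + (c₁ - (w.1 + k₁)).toNat + m) = (w.1 + k₁, r.2 + m) ∧ ω.2.sIn (ω.2.firstHitG + MW + (r.2 - Y').toNat + (k₀ - (r.1 - MW)).toNat + (w.2 - Y').toNat + (c₁ - k₀).toNat + (r.2 - w.2).toNat + (c₁ - (w.1 + k₁)).toNat + m) = .S) ∧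
          ω.2.firstHitG + MW + (r.2 - Y').toNat + (k₀ - (r.1 - MW)).toNat + (w.2 - Y').toNat + (c₁ - k₀).toNat + (r.2 - w.2).toNat + (c₁ - (w.1 + k₁)).toNat + (Y - r.2).toNat = ω.2.arcs.length - 1 - (Y - r.2 - 1).toNat - (c₂ - r.1).toNat)) ∧
      -- new in this car: the prefix (the hook) and the kisses
      ω.2.sOut k₁ = .N ∧
      (∀ m : ℕ, 1 ≤ m → (m : ℤ) ≤ r.2 - w.2 → ω.2.fc (k₁ + m) = (w.1 + k₁, w.2 + m) ∧ ω.2.sIn (k₁ + m) = .S) ∧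
      ω.2.sOut (k₁ + (r.2 - w.2).toNat) = .W ∧
      (∀ m : ℕ, 1 ≤ m → m ≤ k₁ + 1 → ω.2.fc (k₁ + (r.2 - w.2).toNat + m) = (w.1 + k₁ - m, r.2) ∧ ω.2.sIn (k₁ + (r.2 - w.2).toNat + m) = .E) ∧
      ω.2.firstHitG = k₁ + (r.2 - w.2).toNat + k₁ + 1 ∧
      (c₂ = c₁ → (ME : ℤ) = k₁ + 1) ∧
      (∀ l < ω.2.arcs.length, ω.2.fc l = (w.1 + k₁, w.2) → l = k₁ ∨ (k₀ = w.1 + k₁ ∧ l = ω.2.firstHitG + MW + (r.2 - Y').toNat + (k₀ - (r.1 - MW)).toNat + (w.2 - Y').toNat)) ∧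
      (∀ l < ω.2.arcs.length, ω.2.fc l = (w.1 + k₁, r.2) → l = k₁ + (r.2 - w.2).toNat ∨ (c₂ = w.1 + k₁ ∧ l = ω.2.firstHitG + MW + (r.2 - Y').toNat + (k₀ - (r.1 - MW)).toNat + (w.2 - Y').toNat + (c₁ - k₀).toNat + (r.2 - w.2).toNat + (c₁ - (w.1 + k₁)).toNat)) ∧
      (∀ l l' : ℕ, l < ω.2.arcs.length → l' < ω.2.arcs.length → ω.2.fc l = ω.2.fc l' → l ≠ l' →
        (ω.2.fc l = (w.1 + k₁, w.2) ∧ k₀ = w.1 + k₁) ∨ (ω.2.fc l = (w.1 + k₁, r.2) ∧ c₂ = w.1 + k₁)) := by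
  classical
  set n := ω.2.arcs.length with hn
  ---------------------------------------------------------------- basics
  have hF := ω.fh_lt h
  have hlen : 0 < n := by omega
  have h0w : ω.2.fc 0 = w := fc_zero_eq_root w hh ω.2 hlen
  have h0W : ω.2.sIn 0 = .W := YBWalk.sIn_zero_eq_W hh ω.2 hlen
  have h0E : ω.2.sIn 0 ≠ .E := by rw [h0W]; decide
  have h0N : ω.2.sIn 0 ≠ .N := by rw [h0W]; decide
  have h0S : ω.2.sIn 0 ≠ .S := by rw [h0W]; decide
  have hfcF := (fc_fh ω hr h).1
  have hsvr : ∀ l < n, ω.2.fc l = ω.2.fc ω.2.firstHitG → l = ω.2.firstHitG := fun l hl e => eq_firstHitG_of_fc_eq hr h hl e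
  have hn1 : n - 1 < n := by omega
  have hwr : r.1 < w.1 := by omega
  ---------------------------------------------------------------- the prefix (this file) with everything before
  obtain ⟨c₂, c₁, Y, Y', τ1, k₀, MW, ME, k₁, t₂, hY, hY', hr₃, hY'w, ht₂row, ht₂col, hτ1w, hMW1, hME1, hEW, hWW, hnotW, hWE, hEE, hnotE,
    hseven, hall, hN1, hL, hLS, hdesc, hdescIn, heWS, heWnN, hlegN, hlegS, hbWnS, hk₁F, hstr, hk₁ns, hfk, hWk, hk₀w, hbotS, hbWnW, hbEnE, hbEnS,
    hinF, houtF, hrunR, hrunL, hrunB, hrunE, hi₀n, hpass, hclimb, hi₁n, ht₂, hTin, hMT, hrunT, hrunTin, htop,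
    hk₁N, hcolrun, houth, hrowrun, hFeq, hME, hhnE, hgnW⟩ :=
    hookPrefix_of_cost_seven_straight_holeColumn_above hh hr h hA hc hz hstr8 hcol habove hup
  -- hide the disjunctions and the `toNat`-carrying atoms from `omega` until they are rewritten
  have hpassF := Fact.mk hpass
  have htopF := Fact.mk htop
  have hi₀nF := Fact.mk hi₀n
  have hi₁nF := Fact.mk hi₁n
  have hMTF := Fact.mk hMT
  clear hpass htop hi₀n hi₁n hMT ht₂col
  let P : Face → Prop := fun f => f ∈ facesL ω.2.mids ∧ (kindsL ω.2.mids f = [.corner] ∨ kindsL ω.2.mids f = [.coCorner])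
  have hPiso : ∀ k < n, (∀ l < n, ω.2.fc l = ω.2.fc k → l = k) → arcKind (ω.2.sIn k) (ω.2.sOut k) ≠ .straight → P (ω.2.fc k) :=
    fun k hk hsv hkind => isolated_turn hk hsv hkind
  have hmem7 : ∀ f : Face, P f → f = ((r.1 : ℤ), Y) ∨ f = t₂ ∨ f = ((r.1 : ℤ) - MW, Y') ∨ f = (k₀, Y') ∨ f = ((τ1 : ℤ), w.2) ∨
      f = ((r.1 : ℤ) - MW, r.2) ∨ f = ((r.1 : ℤ) + ME, r.2) := by
    intro f hPf
    have := hall f hPf.1 hPf.2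
    simpa only [Finset.mem_insert, Finset.mem_singleton] using this
  have hProw : ∀ f : Face, P f → f.2 = Y ∨ f.2 = Y' ∨ f.2 = w.2 ∨ f.2 = r.2 := by
    intro f hPf
    rcases hmem7 f hPf with rfl | rfl | rfl | rfl | rfl | rfl | rfl
    · exact Or.inl rfl
    · exact Or.inl ht₂row
    · exact Or.inr (Or.inl rfl)
    · exact Or.inr (Or.inl rfl)
    · exact Or.inr (Or.inr (Or.inl rfl))
    · exact Or.inr (Or.inr (Or.inr rfl))
    · exact Or.inr (Or.inr (Or.inr rfl))
  have hbots : ∀ f : Face, P f → f.2 = Y' → f = ((r.1 : ℤ) - MW, Y') ∨ f = (k₀, Y') := by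
    intro f hPf hfY
    rcases hmem7 f hPf with e | e | e | e | e | e | e
    · exfalso; rw [e] at hfY; simp only at hfY; omega
    · exfalso; rw [e, ht₂row] at hfY; omega
    · exact Or.inl e
    · exact Or.inr e
    · exfalso; rw [e] at hfY; simp only at hfY; omega
    · exfalso; rw [e] at hfY; simp only at hfY; omega
    · exfalso; rw [e] at hfY; simp only at hfY; omega
  have htops : ∀ f : Face, P f → f.2 = Y → f = ((r.1 : ℤ), Y) ∨ f = t₂ := by
    intro f hPf hfY
    rcases hmem7 f hPf with e | e | e | e | e | e | e
    · exact Or.inl e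
    · exact Or.inr e
    · exfalso; rw [e] at hfY; simp only at hfY; omega
    · exfalso; rw [e] at hfY; simp only at hfY; omega
    · exfalso; rw [e] at hfY; simp only at hfY; omega
    · exfalso; rw [e] at hfY; simp only at hfY; omega
    · exfalso; rw [e] at hfY; simp only at hfY; omega
  obtain ⟨X', -, hX', -⟩ := exists_right_entry_turn hh hr h
  obtain ⟨X, hXw, hX, -⟩ := exists_left_entry_turn hh hr h hA
  ---------------------------------------------------------------- rows: a plaquette using `E` or `W` lies on one of the four turn rows
  have hrowE : ∀ c : Face, ω.2.UsesSide c .E → c.2 = Y ∨ c.2 = Y' ∨ c.2 = w.2 ∨ c.2 = r.2 := by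
    intro c hcE
    obtain ⟨M, hWall, -, hend⟩ := ω.2.chain_E hX' hcE
    rcases hend with ⟨hM1, hnot⟩ | ⟨-, hs0⟩ | ⟨-, hsZ⟩
    · obtain ⟨i', hi', hfc', hsv', -, -, -, hk'⟩ := ω.2.isolated_of_usesSide_not_opp (hWall M hM1 le_rfl) hnot
      have hP' : P (c.1 + M, c.2) := by rw [← hfc']; exact hPiso i' hi' hsv' hk'
      have := hProw _ hP'; simp only at this; exact this
    · exact absurd hs0 h0E
    · rw [hLS] at hsZ; exact absurd hsZ (by decide)
  have hrowW : ∀ c : Face, ω.2.UsesSide c .W → c.2 = Y ∨ c.2 = Y' ∨ c.2 = w.2 ∨ c.2 = r.2 := by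
    intro c hcW
    obtain ⟨M, hEall, -, hend⟩ := ω.2.chain_W hX hcW
    rcases hend with ⟨hM1, hnot⟩ | ⟨hA0, -⟩ | ⟨-, hsZ⟩
    · obtain ⟨i', hi', hfc', hsv', -, -, -, hk'⟩ := ω.2.isolated_of_usesSide_not_opp (hEall M hM1 le_rfl) hnot
      have hP' : P (c.1 - M, c.2) := by rw [← hfc']; exact hPiso i' hi' hsv' hk'
      have := hProw _ hP'; simp only at this; exact this
    · rw [h0w] at hA0; have := congrArg Prod.snd hA0; simp only at this; exact Or.inr (Or.inr (Or.inl this))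
    · rw [hLS] at hsZ; exact absurd hsZ (by decide)
  have hvert : ∀ i < n, (ω.2.fc i).2 ≠ Y → (ω.2.fc i).2 ≠ Y' → (ω.2.fc i).2 ≠ w.2 → (ω.2.fc i).2 ≠ r.2 →
      arcKind (ω.2.sIn i) (ω.2.sOut i) = .straight := by
    intro i hi h1 h2 h3 h4
    have hnot : ¬(ω.2.UsesSide (ω.2.fc i) .E ∨ ω.2.UsesSide (ω.2.fc i) .W) := by
      rintro (hu | hu)
      · rcases hrowE _ hu with e | e | e | e
        · exact h1 e
        · exact h2 e
        · exact h3 e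
        · exact h4 e
      · rcases hrowW _ hu with e | e | e | e
        · exact h1 e
        · exact h2 e
        · exact h3 e
        · exact h4 e
    have hiE : ω.2.sIn i ≠ .E := fun e => hnot (Or.inl ⟨i, hi, rfl, Or.inl e⟩)
    have hoE : ω.2.sOut i ≠ .E := fun e => hnot (Or.inl ⟨i, hi, rfl, Or.inr e⟩)
    have hiW : ω.2.sIn i ≠ .W := fun e => hnot (Or.inr ⟨i, hi, rfl, Or.inl e⟩)
    have hoW : ω.2.sOut i ≠ .W := fun e => hnot (Or.inr ⟨i, hi, rfl, Or.inr e⟩)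
    have hne := ω.2.sIn_ne_sOut hi
    revert hiE hoE hiW hoW hne
    cases ω.2.sIn i <;> cases ω.2.sOut i <;> decide
  ---------------------------------------------------------------- abbreviations for the pinned indices
  obtain ⟨dB, hdB⟩ : ∃ dB : ℕ, (dB : ℤ) = w.2 - Y' - 1 := ⟨(w.2 - Y' - 1).toNat, by omega⟩
  obtain ⟨dR, hdR⟩ : ∃ dR : ℕ, (dR : ℤ) = k₀ - (r.1 - MW) - 1 := ⟨(k₀ - (r.1 - MW) - 1).toNat, by omega⟩
  obtain ⟨dL, hdL⟩ : ∃ dL : ℕ, (dL : ℤ) = r.2 - Y' - 1 := ⟨(r.2 - Y' - 1).toNat, by omega⟩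
  obtain ⟨dM, hdM⟩ : ∃ dM : ℕ, (dM : ℤ) = r.2 - w.2 - 1 := ⟨(r.2 - w.2 - 1).toNat, by omega⟩
  obtain ⟨dT, hdT⟩ : ∃ dT : ℕ, (dT : ℤ) = Y - r.2 - 1 := ⟨(Y - r.2 - 1).toNat, by omega⟩
  have htoNat : ∀ (a : ℤ) (k : ℕ), a = k → a.toNat = k := fun a k e => by subst e; exact Int.toNat_natCast k
  set x₁ : ℤ := w.1 + k₁ with hx₁def
  have hc₁x : x₁ < c₁ := by rcases hpassF.out with ⟨e1, e2, e3, -⟩ | ⟨e1, -, e3, -⟩ <;> omega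
  have hc₂ : c₂ = c₁ ∨ c₂ = x₁ := by rcases htopF.out with ⟨e, -⟩ | ⟨e, -⟩ <;> [exact Or.inl e; exact Or.inr e]
  have hc₂r : r.1 < c₂ := by rcases hc₂ with e | e <;> omega
  have hc₂F := Fact.mk hc₂
  clear hc₂
  obtain ⟨dC, hdC⟩ : ∃ dC : ℕ, (dC : ℤ) = c₁ - k₀ := ⟨(c₁ - k₀).toNat, by rcases hpassF.out with ⟨e1, e2, e3, -⟩ | ⟨e1, -, e3, -⟩ <;> omega⟩
  obtain ⟨dH, hdH⟩ : ∃ dH : ℕ, (dH : ℤ) = c₁ - x₁ - 1 := ⟨(c₁ - x₁ - 1).toNat, by omega⟩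
  obtain ⟨d₂, hd₂⟩ : ∃ d₂ : ℕ, (d₂ : ℤ) = c₂ - r.1 := ⟨(c₂ - r.1).toNat, by omega⟩
  obtain ⟨jB, hjB⟩ : ∃ jB : ℕ, ω.2.firstHitG + MW + (dL + 1) = jB := ⟨_, rfl⟩
  obtain ⟨jE, hjE⟩ : ∃ jE : ℕ, jB + (dR + 1) = jE := ⟨_, rfl⟩
  obtain ⟨i₀, hi₀⟩ : ∃ i₀ : ℕ, jE + (dB + 1) = i₀ := ⟨_, rfl⟩
  obtain ⟨iC, hiC⟩ : ∃ iC : ℕ, i₀ + dC = iC := ⟨_, rfl⟩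
  obtain ⟨i₁, hi₁⟩ : ∃ i₁ : ℕ, iC + (dM + 1) = i₁ := ⟨_, rfl⟩
  obtain ⟨jT, hjT⟩ : ∃ jT : ℕ, n - 1 - dT = jT := ⟨_, rfl⟩
  have eLF : Fact ((r.2 - Y').toNat = dL + 1) := ⟨htoNat _ _ (by push_cast; omega)⟩
  have eRF : Fact ((k₀ - (r.1 - MW)).toNat = dR + 1) := ⟨htoNat _ _ (by push_cast; omega)⟩
  have eBF : Fact ((w.2 - Y').toNat = dB + 1) := ⟨htoNat _ _ (by push_cast; omega)⟩
  have eCF : Fact ((c₁ - k₀).toNat = dC) := ⟨htoNat _ _ (by omega)⟩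
  have eMF : Fact ((r.2 - w.2).toNat = dM + 1) := ⟨htoNat _ _ (by push_cast; omega)⟩
  have eTF : Fact ((Y - r.2 - 1).toNat = dT) := ⟨htoNat _ _ (by omega)⟩
  have eT1F : Fact ((Y - r.2).toNat = dT + 1) := ⟨htoNat _ _ (by push_cast; omega)⟩
  have e₂F : Fact ((c₂ - r.1).toNat = d₂) := ⟨htoNat _ _ (by omega)⟩
  have eHF : Fact ((c₁ - (w.1 + (k₁ : ℤ))).toNat = dH + 1) := ⟨htoNat _ _ (by push_cast; omega)⟩
  have hIDX0F : Fact (ω.2.firstHitG + MW + (r.2 - Y').toNat + (k₀ - (r.1 - MW)).toNat + (w.2 - Y').toNat = i₀) :=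
    ⟨by rw [eLF.out, eRF.out, eBF.out]; omega⟩
  have hIDX1F : Fact (ω.2.firstHitG + MW + (r.2 - Y').toNat + (k₀ - (r.1 - MW)).toNat + (w.2 - Y').toNat + (c₁ - k₀).toNat +
      (r.2 - w.2).toNat = i₁) := ⟨by rw [eLF.out, eRF.out, eBF.out, eCF.out, eMF.out]; omega⟩
  have hTOPF : Fact (n - 1 - (Y - r.2 - 1).toNat = jT) := ⟨by rw [eTF.out]; exact hjT⟩
  rw [eLF.out] at hrunB
  rw [eLF.out, eRF.out] at hrunE
  have hi₀n := hi₀nF.out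
  rw [hIDX0F.out] at hi₀n
  rw [hIDX0F.out, eCF.out] at hclimb
  have hi₁n := hi₁nF.out
  rw [hIDX1F.out] at hi₁n
  have hMT := hMTF.out
  rw [hTOPF.out, e₂F.out] at hMT
  rw [hTOPF.out] at hTin hrunT hrunTin
  rw [hjB] at hrunB hrunE
  rw [hjE] at hrunE
  rw [show i₀ + dC = iC from hiC] at hclimb
  clear hi₀nF hi₁nF hMTF
  rw [eMF.out] at houth hrowrun hFeq
  have hiC₀ : i₀ ≤ iC := by omega
  have hFi₀ : ω.2.firstHitG < i₀ := by omega
  have hjTn : jT < n := by omega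
  have hNtop := forall_top_ne_N hh hr h hY (by omega)
  have hfcT : ω.2.fc jT = (r.1, Y) := by have := hrunT 0 (by omega); rwa [Nat.sub_zero, Nat.cast_zero, add_zero] at this
  have hlow := prefix_row_ge_of_cost_seven_straight_holeColumn_above hh hr h hA hc hz hstr8 hcol habove hup
  have hhigh := prefix_row_le_of_cost_seven_straight_holeColumn_above hh hr h hA hc hz hstr8 hcol habove hup
  have hmemD : ∀ {c : Face} {s : Side}, ω.2.UsesSide c s → c ∈ D := by
    intro c s hu
    obtain ⟨j, hj, hfj⟩ := ω.2.exists_fc_eq_of_usesSide hu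
    rw [← hfj]; exact (YBWalk.arcFace_arcAt hj).2
  ---------------------------------------------------------------- the hook plaquette and the climb cell
  obtain ⟨jh, hjh⟩ : ∃ jh : ℕ, k₁ + (dM + 1) = jh := ⟨_, rfl⟩
  rw [hjh] at houth hrowrun hFeq
  have hjhn : jh < n := by omega
  obtain ⟨hfch, hinh⟩ := hcolrun (dM + 1) (by omega) (by push_cast; omega)
  rw [hjh] at hfch hinh
  have hfch' : ω.2.fc jh = (x₁, r.2) := by rw [hfch]; exact Prod.ext rfl (by push_cast; omega)
  have hrow_r : ∀ x : ℤ, ω.2.UsesSide (x, r.2) .S → x = r.1 - MW ∨ x = x₁ ∨ x = c₁ := by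
    intro x hu
    obtain ⟨M, hNall, -, hend⟩ := ω.2.chain_S hY' hu
    simp only at hNall hend
    rcases hend with ⟨hM1, hnot⟩ | ⟨-, hs0⟩ | ⟨hZ, -⟩
    · obtain ⟨i', hi', hfc', hsv', -, -, -, hk'⟩ := ω.2.isolated_of_usesSide_not_opp (hNall M hM1 le_rfl) hnot
      have hP' : P (x, r.2 - M) := by rw [← hfc']; exact hPiso i' hi' hsv' hk'
      rcases hmem7 _ hP' with e | e | e | e | e | e | e
      · have := congrArg Prod.snd e; simp only at this; omega
      · have := congrArg Prod.snd e; rw [ht₂row] at this; simp only at this; omega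
      · have := congrArg Prod.fst e; simp only at this; exact Or.inl this
      · have := congrArg Prod.fst e; simp only at this
        rcases hpassF.out with ⟨e1, -, e3, -⟩ | ⟨-, -, e3, -⟩
        · exact Or.inr (Or.inl (by omega))
        · exact Or.inr (Or.inr (by omega))
      · have := congrArg Prod.fst e; simp only at this
        rcases hpassF.out with ⟨-, -, e3, -⟩ | ⟨-, e2, -, -⟩
        · exact Or.inr (Or.inr (by omega))
        · exact Or.inr (Or.inl (by omega))
      · have := congrArg Prod.snd e; simp only at this; omega
      · have := congrArg Prod.snd e; simp only at this; omega
    · exact absurd hs0 h0S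
    · rw [hL] at hZ; have := congrArg Prod.snd hZ; simp only at this; omega
  have hharr : c₂ = x₁ → i₁ + (dH + 1) < n ∧ ω.2.fc (i₁ + (dH + 1)) = (x₁, r.2) ∧ ω.2.sIn (i₁ + (dH + 1)) = .E ∧
      ω.2.sOut (i₁ + (dH + 1)) = .N := by
    intro hcc
    rcases htopF.out with ⟨hcc', -⟩ | ⟨-, -, -, hrunH, houtH, -, hidx⟩
    · omega
    · rw [hIDX1F.out] at hrunH
      rw [hIDX1F.out, eHF.out] at houtH
      rw [hIDX1F.out, eHF.out, eT1F.out, hTOPF.out, e₂F.out] at hidx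
      obtain ⟨eh, einh⟩ := hrunH (dH + 1) (by omega) (by push_cast; omega)
      have hlt : i₁ + (dH + 1) < n := by
        have := hidx; clear hidx
        omega
      exact ⟨hlt, by rw [eh]; exact Prod.ext (by push_cast; omega) rfl, einh, houtH⟩
  ---------------------------------------------------------------- root-row facts for the kisses
  have hrootS : ∀ x : ℤ, ω.2.UsesSide (x, w.2) .S → x = r.1 - MW ∨ x = k₀ := by
    intro x hu
    obtain ⟨M, hNall, -, hend⟩ := ω.2.chain_S hY' hu
    simp only at hNall hend
    rcases hend with ⟨hM1, hnot⟩ | ⟨-, hs0⟩ | ⟨hZ, -⟩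
    · obtain ⟨i', hi', hfc', hsv', -, -, -, hk'⟩ := ω.2.isolated_of_usesSide_not_opp (hNall M hM1 le_rfl) hnot
      have hP' : P (x, w.2 - M) := by rw [← hfc']; exact hPiso i' hi' hsv' hk'
      have hrow' : (((x, w.2 - M) : Face)).2 = Y' := by
        rcases hProw _ hP' with e | e | e | e <;> simp only at e ⊢ <;> omega
      rcases hbots _ hP' hrow' with e | e
      · have := congrArg Prod.fst e; simp only at this; exact Or.inl this
      · have := congrArg Prod.fst e; simp only at this; exact Or.inr this
    · exact absurd hs0 h0S
    · rw [hL] at hZ; have := congrArg Prod.snd hZ; simp only at this; omega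
  have hlegWE : ¬ω.2.UsesSide ((r.1 : ℤ) - MW, w.2) .E := by
    intro hu
    obtain ⟨M, hWall, -, hend⟩ := ω.2.chain_E hX' hu
    simp only at hWall hend
    have hMbig : (MW : ℤ) ≤ M := by
      rcases hend with ⟨hM1, hnot⟩ | ⟨hA0, -⟩ | ⟨hZ, -⟩
      · obtain ⟨i', hi', hfc', hsv', -, -, -, hk'⟩ := ω.2.isolated_of_usesSide_not_opp (hWall M hM1 le_rfl) hnot
        have hP' : P ((r.1 : ℤ) - MW + M, w.2) := by rw [← hfc']; exact hPiso i' hi' hsv' hk'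
        rcases hmem7 _ hP' with e | e | e | e | e | e | e
        · have := congrArg Prod.snd e; simp only at this; omega
        · have := congrArg Prod.snd e; rw [ht₂row] at this; simp only at this; omega
        · have := congrArg Prod.snd e; simp only at this; omega
        · have := congrArg Prod.snd e; simp only at this; omega
        · have := congrArg Prod.fst e; simp only at this; omega
        · have := congrArg Prod.snd e; simp only at this; omega
        · have := congrArg Prod.snd e; simp only at this; omega
      · rw [h0w] at hA0; have := congrArg Prod.fst hA0; simp only at this; omega
      · rw [hL] at hZ; have := congrArg Prod.snd hZ; simp only at this; omega
    have hhole := hmemD (hWall MW hMW1 (by exact_mod_cast hMbig))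
    rw [show (r.1 : ℤ) - MW + MW = r.1 by ring] at hhole
    exact hh (by rw [show holeFaceW w = (r.1, w.2) from Prod.ext (by simp [holeFaceW]; omega) (by simp [holeFaceW])]; exact hhole)
  -- the loop's arrival at `q = (k₀, w.2)` is `fc i₀`, entered from `S`
  obtain ⟨hfcq, hinq⟩ := hrunE (dB + 1) (by omega) (by omega)
  rw [show jE + (dB + 1) = i₀ by omega] at hfcq hinq
  have hfcq' : ω.2.fc i₀ = (k₀, w.2) := by rw [hfcq]; exact Prod.ext rfl (by push_cast; omega)
  ---------------------------------------------------------------- the kisses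
  have hkiss : ∀ l l' : ℕ, l < n → l' < n → ω.2.fc l = ω.2.fc l' → l ≠ l' →
      (ω.2.fc l = (x₁, w.2) ∧ k₀ = x₁) ∨ (ω.2.fc l = (x₁, r.2) ∧ c₂ = x₁) := by
    intro l l' hl hl' hfl hne
    set c := ω.2.fc l with hcdef
    have huse : ∀ s, ω.2.UsesSide c s := fun s => ω.2.usesSide_of_fc_eq hl hl' hne hfl s
    -- its row: it uses `E`, so one of the four rows; not the top (uses `N`), not the bottom (uses `S`)
    have hrow := hrowE c (huse .E)
    have hnY : c.2 ≠ Y := by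
      intro e
      obtain ⟨j, hj, hfj, hs⟩ := huse .N
      have := hNtop j hj (by rw [hfj, e])
      rcases hs with hs | hs
      · exact this.1 hs
      · exact this.2 hs
    have hnY' : c.2 ≠ Y' := by
      intro e
      have := hbotS c.1
      rw [show ((c.1, Y') : Face) = c from Prod.ext rfl e.symm] at this
      exact this (huse .S)
    rcases hrow with e | e | e | e
    · exact absurd e hnY
    · exact absurd e hnY'
    · -- the root row: the column of a bottom turn; west leg excluded; so `q`, and then the kiss at `p₁`
      have hcS := huse .S
      rw [show c = (c.1, w.2) from Prod.ext rfl e] at hcS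
      rcases hrootS _ hcS with hx | hx
      · exfalso
        have := huse .E
        rw [show c = ((r.1 : ℤ) - MW, w.2) from Prod.ext hx e] at this
        exact hlegWE this
      · have hcq : c = (k₀, w.2) := Prod.ext hx e
        rcases hpassF.out with ⟨hk, -⟩ | ⟨-, -, -, -, -, hqnW, -⟩
        · left; exact ⟨by rw [hcq, hk], hk⟩
        · exfalso
          have := huse .W
          rw [hcq] at this
          exact hqnW this
    · -- the row of `r`: `e_W` and the climb cell are excluded, so the hook, and then the hook kiss
      have hcS := huse .S
      rw [show c = (c.1, r.2) from Prod.ext rfl e] at hcS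
      rcases hrow_r _ hcS with hx | hx | hx
      · exfalso
        have := huse .W
        rw [show c = ((r.1 : ℤ) - MW, r.2) from Prod.ext hx e] at this
        exact hnotW this
      · have hch : c = (x₁, r.2) := Prod.ext hx e
        rcases hc₂F.out with hcc | hcc
        · exfalso
          have := huse .E
          rw [hch] at this
          exact hhnE hcc this
        · right; exact ⟨hch, hcc⟩
      · exfalso
        have hcg : c = (c₁, r.2) := Prod.ext hx e
        rcases hc₂F.out with hcc | hcc
        · have := huse .W
          rw [hcg] at this
          exact hgnW hcc this
        · -- with the hook kiss the climb cell is `e_E`, which does not use `E`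
          rcases htopF.out with ⟨hcc', -⟩ | ⟨-, hMEc, -⟩
          · omega
          · have := huse .E
            rw [hcg, show ((c₁, r.2) : Face) = ((r.1 : ℤ) + ME, r.2) from Prod.ext (by simp only; omega) rfl] at this
            exact hnotE this
  -- indices at `p₁` and at the hook
  have hidxp : ∀ l < n, ω.2.fc l = (x₁, w.2) → l = k₁ ∨ (k₀ = x₁ ∧ l = i₀) := by
    intro l hl hfl
    by_cases hlk : l = k₁
    · exact Or.inl hlk
    · right
      rcases hkiss l k₁ hl (by omega) (hfl.trans hfk.symm) hlk with ⟨-, hk⟩ | ⟨hbad, -⟩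
      · refine ⟨hk, ?_⟩
        have hqp : ω.2.fc i₀ = ω.2.fc k₁ := by rw [hfcq', hfk, hk]
        have hik : k₁ ≠ i₀ := by omega
        rcases ω.2.eq_or_eq_of_fc_eq_three (i := k₁) (j := i₀) (l := l) (by omega) (by omega) hl hik hqp (hfl.trans hfk.symm) with e' | e'
        · exact absurd e' hlk
        · exact e'
      · rw [hfl] at hbad; have := congrArg Prod.snd hbad; simp only at this; omega
  have hidxh : ∀ l < n, ω.2.fc l = (x₁, r.2) → l = jh ∨ (c₂ = x₁ ∧ l = i₁ + (dH + 1)) := by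
    intro l hl hfl
    by_cases hlj : l = jh
    · exact Or.inl hlj
    · right
      rcases hkiss l jh hl hjhn (hfl.trans hfch'.symm) hlj with ⟨hbad, -⟩ | ⟨-, hcc⟩
      · rw [hfl] at hbad; have := congrArg Prod.snd hbad; simp only at this; omega
      · refine ⟨hcc, ?_⟩
        obtain ⟨hiH, eh', -, -⟩ := hharr hcc
        have hjk : jh ≠ i₁ + (dH + 1) := by omega
        rcases ω.2.eq_or_eq_of_fc_eq_three (i := jh) (j := i₁ + (dH + 1)) (l := l) hjhn hiH hl hjk (eh'.trans hfch'.symm)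
            (hfl.trans hfch'.symm) with e' | e'
        · exact absurd e' hlj
        · exact e'
  ---------------------------------------------------------------- assemble
  have hpass := hpassF.out
  have htop := htopF.out
  have hIDX0 := hIDX0F.out
  have hIDX1 := hIDX1F.out
  have hTOP := hTOPF.out
  have eH := eHF.out
  have eM : (r.2 - w.2).toNat = dM + 1 := htoNat _ _ (by push_cast; omega)
  have eL : (r.2 - Y').toNat = dL + 1 := htoNat _ _ (by push_cast; omega)
  have eR : (k₀ - (r.1 - MW)).toNat = dR + 1 := htoNat _ _ (by push_cast; omega)
  have eC : (c₁ - k₀).toNat = dC := htoNat _ _ (by omega)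
  have e₂ : (c₂ - r.1).toNat = d₂ := htoNat _ _ (by omega)
  have ht₂col' : t₂.1 ≠ r.1 := by rw [ht₂]; simp only; omega
  refine ⟨c₂, c₁, Y, Y', τ1, k₀, MW, ME, k₁, t₂, hY, hY', hr₃, hY'w, ht₂row, ht₂col', hτ1w, hMW1, hME1, hEW, hWW, hnotW, hWE, hEE, hnotE, hseven, hall,
    hN1, hL, hLS, hdesc, hdescIn, heWS, heWnN, hlegN, hlegS, hbWnS, hk₁F, hstr, hk₁ns, hfk, hWk, hk₀w, hbotS, hbWnW, hbEnE, hbEnS, hinF, houtF,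
    hrunR, hrunL, ?_, ?_, ?_, hpass, ?_, ?_, ht₂, ?_, ?_, ?_, ?_, htop, hk₁N, hcolrun, ?_, ?_, ?_, hME, ?_, ?_, ?_⟩
  · rw [eL, hjB]; exact hrunB
  · rw [eL, eR, hjB, hjE]; exact hrunE
  · rw [hIDX0]; exact hi₀n
  · rw [hIDX0, eC, hiC]; exact hclimb
  · rw [hIDX1]; exact hi₁n
  · rw [hTOP]; exact hTin
  · rw [hTOP, e₂]; exact hMT
  · rw [hTOP]; exact hrunT
  · rw [hTOP]; exact hrunTin
  · rw [eM, hjh]; exact houth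
  · rw [eM, hjh]; exact hrowrun
  · rw [eM, hjh]; exact hFeq
  · intro l hl hfl
    rw [hIDX0]; exact hidxp l hl hfl
  · intro l hl hfl
    rw [hIDX1, eH, eM, hjh]; exact hidxh l hl hfl
  · intro l l' hl hl' hfl hne; exact hkiss l l' hl hl' hfl hne

end ΩG

end Literature.Probability.RandomPlanarGeometry.SAW.YangBaxter
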